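import Summits.KontsevichZagierPeriods.KontsevichZagierPeriods.Theses.HurwitzMicroSectors
import Literature.NumberTheory.Transcendental.KZCalculusProofs
import Literature.NumberTheory.Transcendental.KZRulesAssociator
import Literature.NumberTheory.Transcendental.KZSubcalculusInvariants
import Literature.NumberTheory.Transcendental.KZKernelConjectureForms
import Literature.NumberTheory.Transcendental.KZIntervalPeriodProofs
import Literature.NumberTheory.Transcendental.KZProductIdeal
import Summits.KontsevichZagierPeriods.KontsevichZagierPeriods.Theorems.StuffleInKZ.Negative.AlgebraicShadow
import Summits.KontsevichZagierPeriods.KontsevichZagierPeriods.Theorems.LogPrimitiveNL.Negative.DimZero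

/-!
# Disproof of `NormalFormPrinciple` — findings (cdisprove, standing adversary; cycle 1, 2026-08-16)

Crux `HurwitzMicroSectors.NormalFormPrinciple` (item stmt-KontsevichZagierPeriods-3869):
`∃ 𝒩, Rigidity 𝒩 ∧ Reduction 𝒩` over the H21 calculus `KZ.relations`.

**Findings (all `theorem`s below are kernel-checked unless marked `sorry`):**

1. `normalFormPrinciple_iff_statement` / `_iff_kernel`: the crux is EQUIVALENT to the summit
   `KontsevichZagierPeriods` and to `KZKernelConjecture` (`ker eval = relations`). A kill is a
   disproof of Conjecture 1 for the fixed H21 calculus — nothing less (summit strength).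
2. `not_normalFormPrinciple_iff_invariant`: obstruction shape — `¬ NormalFormPrinciple` holds iff
   there is an additive invariant `ι : FormalRep →+ A` killing the four move sets and separating
   one equal-valued pair of RATIONAL representations. No such invariant is known (route Neg).
3. Load-bearing analysis of the STATEMENT: each half alone is trivially satisfiable
   (`…WithoutReduction_holds`: `𝒩 = ∅`; `…WithoutRigidity_holds`: `𝒩 = univ`), and rigidity on
   `𝒩 = univ` is again the summit (`rigidity_univ_iff_statement`): the content is the coupling.
4. Load-bearing analysis of the CALCULUS (which printed rule any proof must use), as refutations
   of the crux over sub-calculi `NormalFormPrincipleMod S`, `S = closure (some moves)`: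
   * WITHOUT Newton–Leibniz (rules 1a, 1b, 2 only): FALSE — `normalFormPrinciple_false_without_newtonLeibniz`;
     invariant = evaluation of the dimension-0 generators only (`evalZero`); witness `[pt, 1]`
     against its slab `[[0,1], 1]`.
   * WITHOUT both additivity rules (rules 2, 3 only): FALSE — `normalFormPrinciple_false_without_additivity`;
     invariant = number of generators with EMPTY domain (`emptyCount`); witness `[∅, 0]` (dim 0)
     against `[pt, 0]`. (Degenerate but honest: only rule 1 disposes of the empty representation.)
   * WITHOUT change of variables (rules 1a, 1b, 3): FALSE — `normalFormPrinciple_false_without_changeOfVariables`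
     (PROVED, sorry-free): invariant `Λcov` = the first-coordinate window `∫_{σ ∩ {0 < x₀ < 1}} f`
     modulo real algebraic numbers; witness the two arctan representations of `π/4` on `[0,1]`
     and `[−1,0]`; uses Lindemann (`transcendental_pi_holds`, proved in tree) and algebraicity of
     values of ℚ-semialgebraic functions over the point. Scope, now a THEOREM (§4.3b
     `arctan_pair_mem_closure_nl_swap`, `arctan_pair_equivalent`): the same pair is reconnected by
     two Newton–Leibniz moves and ONE coordinate transposition (bridge `[[−1,0]×[0,1], k(s−t)]`,
     `K(x+1) − K(x) = 1/(1+x²)`), so the load-bearing content of rule 2) isolated here is exactly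
     "a coordinate permutation" (≡ rule 3 along a non-last coordinate), cf. [Ayoub2015, Rem. 1.5].
   * WITHOUT domain additivity 1a (rules 1b, 2, 3): FALSE on paper — `…_false_without_domainAdd`
     (sorry): invariant `χ(σ)`-twisted evaluation, `χ` = o-minimal Euler characteristic
     (invariant under definable bijections and constant-χ fibrations); witness `[(0,1), 1]` vs
     `[[0,1], 1]`. Not formalisable now (no o-minimal Euler characteristic in Mathlib).
   * WITHOUT integrand additivity 1b (rules 1a, 2, 3): NO CHANGE — 1b is a derived rule
     (`integrandAddRel_subset_closure_domainAdd_newtonLeibniz`, PROVED: C¹ smoothstep primitive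
     `f₁ φ(t)` / `f₁ + f₂ φ(t−1)` on the double slab `σ × [0,2]`, one domain-additivity and three
     Newton–Leibniz moves; `closure_without_integrandAdd_eq_relations`).
5. Refuted natural strengthening: no family with finitely many VALUES can reduce all rational
   representations (`not_exists_finite_values`), since every natural number is a value.
6. Formalisation-bug hunt on `KZCalculus.lean` (dim 0 has volume 1; null-domain and
   zero-integrand reps are `≡ 0` by rule 1; `|det|`; `a ≤ b` in rule 3; `IsRational` needs
   `q ≠ 0` on `σ`): no exploitable defect found — see `of_nullDomain_mem_relations`,
   `of_zeroIntegrand_mem_relations`.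

RELATION TO LANDED NEGATIVE KNOWLEDGE (learned 2026-08-16T05:35Z from the reviews of the first
landing attempt; CITED, and the landing set `Theorems/NormalFormPrinciple/Negative/` is rebased on
them): `HurwitzSectorComplement.Negative.Core` (sibling crux 14341) already has
`nfp_iff_statement`, the separating-invariant template and the trivial halves; the cdisprove seat
of `StuffleInKZ` (route FurushoPentagon) already landed the sub-calculus theory —
`StuffleInKZ.Negative.NewtonLeibnizFree` (`gradedEval`, `nlFreeRelations`, `not_kernel_le_nlFree`:
§4.1 below is a REDISCOVERY), `…AlgebraicShadow` + `…ChangeOfVariablesFree` (`covFreeRelations`,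
the algebraic shadow of the first-axis marginal, a swap witness, `not_kernel_le_covFree`: §4.3
below proves the same THEOREM with a DIFFERENT invariant), `…IntegrandAdditivityDerived`
(`Derived.relations_eq_closure_three_rules`: §4.5 below is a REDISCOVERY),
`…AdditivityOnly`/`…LoadBearing` (`locEval`, `aug`, `covNLRelations`). What is NEW here: the
arithmetic invariant `Λcov` and its COMPLEMENTARITY to the algebraic shadow (the arctan reflection
pair is one-dimensional, hence has an algebraic shadow by `hasAlgShadow_of_dim_one`, yet
`Λcov ≠ 0`: `exists_kernel_algShadow_not_mem_covFreeRelations` in the landing file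
`ArctanWitness.lean`), the `emptyCount` refutation of the Conjecture form over `⟨2,3⟩`, the
relative forms `NormalFormPrincipleMod S` with the NFP corollaries, the transposition bridge, and
the finite-values refutation.

WHY IT RESISTS: by (1)–(2) a kill is an additive invariant of `FormalRep` finer than `eval` on the
full calculus; (4) shows that each of the cheap invariants (dimension grading, empty count,
windowed marginals mod ℚ̄, Euler characteristic) is killed by exactly one of the printed rules,
and the full rule set kills them all: `evalZero` dies under rule 3) (slabs), `emptyCount` under
rule 1), `Λcov` under rule 2) (translate the window), `χ`-twists under rule 1a). The only live candidates are route Neg's (Gauss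
multiplication pair 0311, cancellation gap 11011), both open.
-/

noncomputable section

set_option linter.dupNamespace false

open MeasureTheory Set intervalIntegral
open Literature.NumberTheory.Transcendental Literature.NumberTheory.Transcendental.KZ
open Literature.ModelTheory.ExponentialFields (IsSemialgebraic)

namespace Summit.KontsevichZagierPeriods.KontsevichZagierPeriods.Cruxes.NormalFormPrinciple.Disproof

open Summit.KontsevichZagierPeriods.KontsevichZagierPeriods.Theses.HurwitzMicroSectors
  (NormalFormPrinciple)
open Summit.KontsevichZagierPeriods.LiouvilleUnfolding.LogPrimitiveNL.Negative
  (isSemialgebraicFunOn_endpoint isAlgebraic_of_isSemialgebraicFunOn_fin_zero)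

variable {n m : ℕ}

/-! ## §0 The two halves, relative to a subgroup of formal relations -/

/-- A family of "normal forms", one set of representations per dimension. -/
abbrev Family : Type := (n : ℕ) → Set (IntegralRep n)

/-- Rigidity half of the crux relative to a subgroup `S ⊆ FormalRep` (`S = relations` is the
crux's): members of `𝒩` with equal values differ by an element of `S`. -/
def RigidityMod (S : AddSubgroup FormalRep) (𝒩 : Family) : Prop :=
  ∀ (n m : ℕ) (N : IntegralRep n) (N' : IntegralRep m),
    N ∈ 𝒩 n → N' ∈ 𝒩 m → N.value = N'.value → of N - of N' ∈ S

/-- Reduction half of the crux relative to `S`: every rational representation differs from a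
member of `𝒩` by an element of `S`. -/
def ReductionMod (S : AddSubgroup FormalRep) (𝒩 : Family) : Prop :=
  ∀ (n : ℕ) (r : IntegralRep n), r.IsRational →
    ∃ (m : ℕ) (N : IntegralRep m), N ∈ 𝒩 m ∧ of r - of N ∈ S

/-- The crux relative to a subgroup of formal relations. -/
def NormalFormPrincipleMod (S : AddSubgroup FormalRep) : Prop :=
  ∃ 𝒩 : Family, RigidityMod S 𝒩 ∧ ReductionMod S 𝒩

/-- Conjecture 1 (two rational representations) relative to a subgroup of formal relations. -/
def ConjectureMod (S : AddSubgroup FormalRep) : Prop :=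
  ∀ (n m : ℕ) (r : IntegralRep n) (r' : IntegralRep m),
    r.IsRational → r'.IsRational → r.value = r'.value → of r - of r' ∈ S

/-- The crux IS `NormalFormPrincipleMod relations` (definitional). -/
theorem normalFormPrinciple_iff_mod : NormalFormPrinciple ↔ NormalFormPrincipleMod relations :=
  Iff.rfl

/-- Values are preserved by any subgroup of sound relations. -/
theorem value_eq_of_sub_mem {S : AddSubgroup FormalRep} (hS : S ≤ eval.ker)
    {a b : ℕ} (ra : IntegralRep a) (rb : IntegralRep b) (h : of ra - of rb ∈ S) :
    ra.value = rb.value := by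
  have := hS h
  rwa [AddMonoidHom.mem_ker, map_sub, eval_of, eval_of, sub_eq_zero] at this

/-- **Assembly, relative form.** Over any SOUND subgroup `S` (values preserved), normal forms give
Conjecture 1 relative to `S`: reduce both sides, compare values, apply rigidity, compose. -/
theorem conjectureMod_of_normalFormPrincipleMod {S : AddSubgroup FormalRep} (hS : S ≤ eval.ker)
    (h : NormalFormPrincipleMod S) : ConjectureMod S := by
  obtain ⟨𝒩, hrig, hred⟩ := h
  intro n m r r' hr hr' hv
  obtain ⟨k, N, hN, hrN⟩ := hred n r hr
  obtain ⟨k', N', hN', hrN'⟩ := hred m r' hr'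
  have hNN' : N.value = N'.value := by
    rw [← value_eq_of_sub_mem hS r N hrN, ← value_eq_of_sub_mem hS r' N' hrN', hv]
  have h3 := hrig k k' N N' hN hN' hNN'
  have : of r - of r' = (of r - of N) + (of N - of N') - (of r' - of N') := by abel
  rw [this]
  exact S.sub_mem (S.add_mem hrN h3) hrN'

/-- Conversely Conjecture 1 relative to `S` gives normal forms relative to `S`
(`𝒩 :=` the rational representations themselves). -/
theorem normalFormPrincipleMod_of_conjectureMod {S : AddSubgroup FormalRep} (h : ConjectureMod S) :
    NormalFormPrincipleMod S :=
  ⟨fun _ => {r | r.IsRational}, fun n m N N' hN hN' hv => h n m N N' hN hN' hv,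
    fun n r hr => ⟨n, r, hr, by rw [sub_self]; exact S.zero_mem⟩⟩

/-- Over a sound subgroup, normal forms ⇔ Conjecture 1. -/
theorem normalFormPrincipleMod_iff {S : AddSubgroup FormalRep} (hS : S ≤ eval.ker) :
    NormalFormPrincipleMod S ↔ ConjectureMod S :=
  ⟨conjectureMod_of_normalFormPrincipleMod hS, normalFormPrincipleMod_of_conjectureMod⟩

/-- Soundness of the full calculus, as an inequality of subgroups. -/
theorem relations_le_ker : relations ≤ eval.ker := relations_le_ker_eval_holds

/-! ## §1 Summit strength -/

/-- **The crux is the summit.** `NormalFormPrinciple ↔ KontsevichZagierPeriods`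
(→ is the route's `closes`; ← takes `𝒩 :=` rational representations). Consequently a disproof of
the crux is a disproof of Conjecture 1 for the H21 calculus, and conversely. -/
theorem normalFormPrinciple_iff_statement : NormalFormPrinciple ↔ KontsevichZagierPeriods := by
  rw [normalFormPrinciple_iff_mod, normalFormPrincipleMod_iff relations_le_ker]
  exact ⟨fun h n m r r' hr hr' hv => h n m r r' hr hr' hv,
    fun h n m r r' hr hr' hv => h r r' hr hr' hv⟩

/-- The crux is the kernel form `ker eval = relations` of the period conjecture. -/
theorem normalFormPrinciple_iff_kernel : NormalFormPrinciple ↔ KZKernelConjecture :=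
  normalFormPrinciple_iff_statement.trans
    (KontsevichZagierPeriods_iff.trans kzKernelConjecture_iff_isRational.symm)

/-- The negation of the crux is route Neg's thesis `¬ KontsevichZagierPeriods`. -/
theorem not_normalFormPrinciple_iff : ¬ NormalFormPrinciple ↔ ¬ KontsevichZagierPeriods :=
  not_congr normalFormPrinciple_iff_statement

/-! ## §2 Load-bearing analysis of the statement: each half alone is trivial -/

/-- The crux with the reduction half dropped. -/
def NormalFormPrincipleWithoutReduction : Prop := ∃ 𝒩 : Family, RigidityMod relations 𝒩

/-- The crux with the rigidity half dropped. -/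
def NormalFormPrincipleWithoutRigidity : Prop := ∃ 𝒩 : Family, ReductionMod relations 𝒩

/-- Rigidity alone is trivially satisfiable: `𝒩 = ∅`. -/
theorem normalFormPrincipleWithoutReduction_holds : NormalFormPrincipleWithoutReduction :=
  ⟨fun _ => ∅, fun _ _ _ _ hN _ _ => hN.elim⟩

/-- Reduction alone is trivially satisfiable: `𝒩 = univ`. -/
theorem normalFormPrincipleWithoutRigidity_holds : NormalFormPrincipleWithoutRigidity :=
  ⟨fun _ => univ, fun n r _ => ⟨n, r, mem_univ _, by rw [sub_self]; exact relations.zero_mem⟩⟩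

/-- No free lunch at the other extreme: rigidity for `𝒩 = univ` is the summit again
(all-representations form `KZPeriodConjecture'` ⇔ rational form). -/
theorem rigidity_univ_iff_statement : RigidityMod relations (fun _ => univ) ↔ KontsevichZagierPeriods := by
  have h1 : RigidityMod relations (fun _ => univ) ↔ KZPeriodConjecture' :=
    ⟨fun h n m r r' hv => h n m r r' (mem_univ _) (mem_univ _) hv,
      fun h n m r r' _ _ hv => h r r' hv⟩
  rw [h1, kzPeriodConjecture'_iff_isRational]
  rfl

/-! ## §3 Obstruction shape: what a disproof must be -/

/-- **Obstruction shape (biconditional).** The crux fails iff some additive invariant of the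
formal group kills all four move sets yet separates one pair of equal-valued RATIONAL
representations. (→: the quotient map `FormalRep → FormalRep ⧸ relations`; ←: `closure_le`.)
Any refutation — of this crux, of the summit, of route Neg's cruxes — must exhibit such an `ι`. -/
theorem not_normalFormPrinciple_iff_invariant :
    ¬ NormalFormPrinciple ↔
      ∃ (A : Type) (_ : AddCommGroup A) (ι : FormalRep →+ A),
        (∀ c ∈ domainAddRel ∪ integrandAddRel ∪ changeOfVariablesRel ∪ newtonLeibnizRel, ι c = 0) ∧
        ∃ (n m : ℕ) (r : IntegralRep n) (r' : IntegralRep m),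
          r.IsRational ∧ r'.IsRational ∧ r.value = r'.value ∧ ι (of r - of r') ≠ 0 := by
  rw [not_normalFormPrinciple_iff]
  constructor
  · intro h
    have h' : ∃ (n m : ℕ) (r : IntegralRep n) (r' : IntegralRep m),
        r.IsRational ∧ r'.IsRational ∧ r.value = r'.value ∧ ¬ Equivalent r r' := by
      by_contra hne
      apply h
      intro n m r r' hr hr' hv
      by_contra hE
      exact hne ⟨n, m, r, r', hr, hr', hv, hE⟩
    obtain ⟨n, m, r, r', hr, hr', hv, hne⟩ := h'
    refine ⟨FormalRep ⧸ relations, inferInstance, QuotientAddGroup.mk' relations, ?_,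
      n, m, r, r', hr, hr', hv, ?_⟩
    · intro c hc
      exact (QuotientAddGroup.eq_zero_iff c).mpr (AddSubgroup.subset_closure hc)
    · intro h0
      exact hne ((QuotientAddGroup.eq_zero_iff _).mp h0)
  · rintro ⟨A, _, ι, hι, n, m, r, r', hr, hr', hv, hne⟩ h
    apply hne
    have hle : relations ≤ ι.ker := (AddSubgroup.closure_le _).mpr fun c hc => hι c hc
    exact hle (h r r' hr hr' hv)

/-! ## §4 Load-bearing analysis of the calculus: sub-calculi -/

/-- General refutation template for a sub-calculus: a sound subgroup `S` and one equal-valued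
rational pair outside `S` kill the crux relative to `S`. -/
theorem not_normalFormPrincipleMod_of_witness {S : AddSubgroup FormalRep} (hS : S ≤ eval.ker)
    {a b : ℕ} (r : IntegralRep a) (r' : IntegralRep b) (hr : r.IsRational) (hr' : r'.IsRational)
    (hv : r.value = r'.value) (hno : of r - of r' ∉ S) : ¬ NormalFormPrincipleMod S :=
  fun h => hno (conjectureMod_of_normalFormPrincipleMod hS h a b r r' hr hr' hv)

/-! ### §4.1 Without Newton–Leibniz (rules 1a, 1b, 2): FALSE -/

/-- Relations of the sub-calculus without rule 3). -/
def relationsNoNL : AddSubgroup FormalRep :=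
  AddSubgroup.closure (domainAddRel ∪ integrandAddRel ∪ changeOfVariablesRel)

theorem relationsNoNL_le_relations : relationsNoNL ≤ relations :=
  AddSubgroup.closure_mono subset_union_left

/-- The crux over the calculus without Newton–Leibniz. -/
def NormalFormPrincipleWithoutNewtonLeibniz : Prop := NormalFormPrincipleMod relationsNoNL

/-- Projection of the formal group onto its dimension-0 generators. -/
def projZero : FormalRep →+ FormalRep :=
  FreeAbelianGroup.lift fun r => if r.1 = 0 then FreeAbelianGroup.of r else 0

/-- **The invariant**: evaluate only the 0-dimensional generators. -/
def evalZero : FormalRep →+ ℝ := eval.comp projZero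

@[simp] theorem projZero_of (r : IntegralRep n) : projZero (of r) = if n = 0 then of r else 0 := by
  simp [projZero, of]

/-- Rules 1a, 1b, 2 act inside one dimension; `evalZero` of an instance is `eval` of it (dimension
0, zero by soundness) or `0`. -/
theorem evalZero_eq_zero_of_mem_domainAddRel {c : FormalRep} (hc : c ∈ domainAddRel) :
    evalZero c = 0 := by
  have h0 := eval_eq_zero_of_mem_domainAddRel_holds hc
  obtain ⟨k, r, r₁, r₂, -, -, -, -, rfl⟩ := hc
  by_cases hk : k = 0
  · subst hk
    simpa [evalZero] using h0
  · simp [evalZero, hk]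

theorem evalZero_eq_zero_of_mem_integrandAddRel {c : FormalRep} (hc : c ∈ integrandAddRel) :
    evalZero c = 0 := by
  have h0 := eval_eq_zero_of_mem_integrandAddRel_holds hc
  obtain ⟨k, r, r₁, r₂, -, -, -, rfl⟩ := hc
  by_cases hk : k = 0
  · subst hk
    simpa [evalZero] using h0
  · simp [evalZero, hk]

theorem evalZero_eq_zero_of_mem_changeOfVariablesRel {c : FormalRep} (hc : c ∈ changeOfVariablesRel) :
    evalZero c = 0 := by
  have h0 := eval_eq_zero_of_mem_changeOfVariablesRel_holds hc
  obtain ⟨k, r, r', Φ, Φ', -, -, -, -, -, rfl⟩ := hc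
  by_cases hk : k = 0
  · subst hk
    simpa [evalZero] using h0
  · simp [evalZero, hk]

/-- **Rules 1a, 1b, 2 preserve `evalZero`.** -/
theorem relationsNoNL_le_ker_evalZero : relationsNoNL ≤ evalZero.ker := by
  refine (AddSubgroup.closure_le _).mpr ?_
  rintro c ((hc | hc) | hc)
  · exact evalZero_eq_zero_of_mem_domainAddRel hc
  · exact evalZero_eq_zero_of_mem_integrandAddRel hc
  · exact evalZero_eq_zero_of_mem_changeOfVariablesRel hc

/-- The witness: the unit slab `[[0,1] ⊂ ℝ¹, 1]`, one Newton–Leibniz move above `[pt, 1]`. -/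
def unitSlab : IntegralRep 1 := IntegralRep.unit.slab 0

theorem isRational_unit : IntegralRep.unit.IsRational :=
  ⟨1, 1, fun _ _ => by simp, fun _ _ => by simp⟩

theorem isRational_unitSlab : unitSlab.IsRational :=
  ⟨1, 1, fun _ _ => by simp, fun _ _ => by simp [unitSlab]⟩

theorem value_unitSlab : unitSlab.value = 1 := by
  rw [← IntegralRep.value_unit]
  exact (Equivalent.value_eq_holds (IntegralRep.unit.equivalent_slab 0)).symm

theorem evalZero_witness : evalZero (of IntegralRep.unit - of unitSlab) = 1 := by
  simp [evalZero, unitSlab]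

/-- `[pt, 1] − [[0,1], 1]` is not a relation of the calculus without Newton–Leibniz. -/
theorem witness_not_mem_relationsNoNL : of IntegralRep.unit - of unitSlab ∉ relationsNoNL := by
  intro h
  have := relationsNoNL_le_ker_evalZero h
  rw [AddMonoidHom.mem_ker, evalZero_witness] at this
  exact one_ne_zero this

/-- **Any proof of the crux must use rule 3).** Over the sub-calculus generated by additivity
and change of variables the crux is FALSE: `[pt, 1]` and `[[0,1], 1]` are rational, both of
value `1`, and separated by `evalZero`. -/
theorem normalFormPrinciple_false_without_newtonLeibniz : ¬ NormalFormPrincipleWithoutNewtonLeibniz :=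
  not_normalFormPrincipleMod_of_witness (relationsNoNL_le_relations.trans relations_le_ker)
    IntegralRep.unit unitSlab isRational_unit isRational_unitSlab
    (by rw [value_unitSlab, IntegralRep.value_unit]) witness_not_mem_relationsNoNL

/-! ### §4.2 Without additivity (rules 2, 3 only): FALSE (degenerate mechanism) -/

/-- Relations of the sub-calculus without rule 1). -/
def relationsNoAdd : AddSubgroup FormalRep :=
  AddSubgroup.closure (changeOfVariablesRel ∪ newtonLeibnizRel)

theorem relationsNoAdd_le_relations : relationsNoAdd ≤ relations :=
  AddSubgroup.closure_mono (union_subset (subset_union_right.trans subset_union_left) subset_union_right)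

/-- The crux over the calculus without the additivity rules. -/
def NormalFormPrincipleWithoutAdditivity : Prop := NormalFormPrincipleMod relationsNoAdd

open Classical in
/-- **The invariant**: the number of generators with empty domain. -/
def emptyCount : FormalRep →+ ℤ :=
  FreeAbelianGroup.lift fun r => if r.2.domain = ∅ then 1 else 0

open Classical in
@[simp] theorem emptyCount_of (r : IntegralRep n) :
    emptyCount (of r) = if r.domain = ∅ then 1 else 0 := by
  simp [emptyCount, of]

/-- A change of variables maps an empty domain to an empty domain and a non-empty one to a
non-empty one. -/
theorem emptyCount_eq_zero_of_mem_changeOfVariablesRel {c : FormalRep} (hc : c ∈ changeOfVariablesRel) :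
    emptyCount c = 0 := by
  obtain ⟨k, r, r', Φ, Φ', -, -, -, hdom, -, rfl⟩ := hc
  have : r'.domain = ∅ ↔ r.domain = ∅ := by rw [hdom, image_eq_empty]
  by_cases h : r.domain = ∅
  · simp [h, this.mpr h]
  · simp [h, mt this.mp h]

/-- A Newton–Leibniz band over `τ` with `a ≤ b` is empty iff `τ` is. -/
theorem emptyCount_eq_zero_of_mem_newtonLeibnizRel {c : FormalRep} (hc : c ∈ newtonLeibnizRel) :
    emptyCount c = 0 := by
  obtain ⟨k, r, r', a, b, F, -, -, -, hab, hdom, -, -, -, rfl⟩ := hc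
  have hiff : r.domain = ∅ ↔ r'.domain = ∅ := by
    constructor
    · intro h
      by_contra hne
      obtain ⟨x, hx⟩ := nonempty_iff_ne_empty.mpr hne
      have : (Fin.snoc x (a x) : Fin (k + 1) → ℝ) ∈ r.domain := by
        rw [hdom]
        simp [hx, hab x hx]
      rw [h] at this
      exact this
    · intro h
      rw [hdom, eq_empty_iff_forall_notMem]
      intro z hz
      have : Fin.init z ∈ r'.domain := hz.1
      rw [h] at this
      exact this
  by_cases h : r'.domain = ∅
  · simp [h, hiff.mpr h]
  · simp [h, mt hiff.mp h]

/-- **Rules 2, 3 preserve `emptyCount`.** -/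
theorem relationsNoAdd_le_ker_emptyCount : relationsNoAdd ≤ emptyCount.ker := by
  refine (AddSubgroup.closure_le _).mpr ?_
  rintro c (hc | hc)
  · exact emptyCount_eq_zero_of_mem_changeOfVariablesRel hc
  · exact emptyCount_eq_zero_of_mem_newtonLeibnizRel hc

/-- The zero constant `[pt, 0]` in dimension 0. -/
def zeroPt : IntegralRep 0 where
  domain := univ
  integrand := fun _ => 0
  isSemialgebraic_domain := Literature.ModelTheory.ExponentialFields.isSemialgebraic_univ
  isSemialgebraicFunOn_integrand := by
    simpa using isSemialgebraicFunOn_aeval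
      (Literature.ModelTheory.ExponentialFields.isSemialgebraic_univ (k := ℚ) (ι := Fin 0) (R := ℝ))
      (0 : MvPolynomial (Fin 0) ℚ)
  integrableOn := integrableOn_const (hs := by simp [volume_univ_fin_zero])

theorem isRational_zeroPt : zeroPt.IsRational := ⟨0, 1, fun _ _ => by simp, fun _ _ => by simp [zeroPt]⟩

theorem isRational_empty : (IntegralRep.empty 0).IsRational := ⟨0, 1, fun _ h => h.elim, fun _ h => h.elim⟩

@[simp] theorem value_zeroPt : zeroPt.value = 0 := by simp [IntegralRep.value, zeroPt]

theorem emptyCount_witness : emptyCount (of (IntegralRep.empty 0) - of zeroPt) = 1 := by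
  have h1 : (IntegralRep.empty 0).domain = ∅ := rfl
  have h2 : zeroPt.domain ≠ ∅ := by simp [zeroPt]
  simp [h2]

theorem witness_not_mem_relationsNoAdd : of (IntegralRep.empty 0) - of zeroPt ∉ relationsNoAdd := by
  intro h
  have := relationsNoAdd_le_ker_emptyCount h
  rw [AddMonoidHom.mem_ker, emptyCount_witness] at this
  exact one_ne_zero this

/-- **Any proof of the crux must use rule 1).** Over the sub-calculus generated by change of
variables and Newton–Leibniz, `[∅, 0]` and `[pt, 0]` (rational, value `0`) are separated by
`emptyCount`. (With rule 1a, `[∅] ≡ 0`: `KZ.IntegralRep.of_empty_mem_relations`.) -/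
theorem normalFormPrinciple_false_without_additivity : ¬ NormalFormPrincipleWithoutAdditivity :=
  not_normalFormPrincipleMod_of_witness (relationsNoAdd_le_relations.trans relations_le_ker)
    (IntegralRep.empty 0) zeroPt isRational_empty isRational_zeroPt
    (by rw [IntegralRep.value_empty, value_zeroPt]) witness_not_mem_relationsNoAdd

/-! ### §4.3 Without change of variables (rules 1a, 1b, 3): FALSE -/

/-- The window family: nothing in dimension `0`, the first-coordinate slab `0 < x₀ < 1` above. -/
def wnd : (n : ℕ) → Set (Fin n → ℝ)
  | 0 => ∅
  | _ + 1 => {x | x 0 ∈ Ioo (0:ℝ) 1}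

@[simp] theorem wnd_zero : wnd 0 = ∅ := rfl

theorem wnd_succ (k : ℕ) : wnd (k + 1) = {x : Fin (k + 1) → ℝ | x 0 ∈ Ioo (0:ℝ) 1} := rfl

theorem isSemialgebraic_wnd : ∀ n, IsSemialgebraic ℚ (wnd n)
  | 0 => Literature.ModelTheory.ExponentialFields.isSemialgebraic_empty
  | k + 1 => by
    have h1 := Literature.ModelTheory.ExponentialFields.isSemialgebraic_setOf_eval_pos (k := ℚ)
      (R := ℝ) (MvPolynomial.X 0 : MvPolynomial (Fin (k + 1)) ℚ)
    have h2 := Literature.ModelTheory.ExponentialFields.isSemialgebraic_setOf_eval_lt (k := ℚ)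
      (R := ℝ) (MvPolynomial.X 0 : MvPolynomial (Fin (k + 1)) ℚ) (1 : MvPolynomial (Fin (k + 1)) ℚ)
    simp only [MvPolynomial.aeval_X, map_one] at h1 h2
    convert h1.inter h2 using 1
    ext x
    simp [wnd_succ, mem_Ioo]

theorem measurableSet_wnd (n : ℕ) : MeasurableSet (wnd n) :=
  Literature.ModelTheory.ExponentialFields.IsSemialgebraic.measurableSet_holds (isSemialgebraic_wnd n)

/-- **The windowed evaluation**: integrate each generator over `domain ∩ {0 < x₀ < 1}` only
(`0` in dimension `0`). -/
def windowEval : FormalRep →+ ℝ := restrictedEval wnd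

@[simp] theorem windowEval_of (r : IntegralRep n) :
    windowEval (of r) = ∫ x in r.domain ∩ wnd n, r.integrand x :=
  restrictedEval_of wnd r

/-- The additive group of real algebraic numbers. -/
def algReal : AddSubgroup ℝ := (integralClosure ℚ ℝ).toSubring.toAddSubgroup

theorem mem_algReal {x : ℝ} : x ∈ algReal ↔ IsAlgebraic ℚ x := by
  simp [algReal, mem_integralClosure_iff, isAlgebraic_iff_isIntegral]

/-- **The invariant of the calculus without rule 2)**: windowed evaluation modulo `ℚ̄ ∩ ℝ`. -/
def Λcov : FormalRep →+ ℝ ⧸ algReal := (QuotientAddGroup.mk' algReal).comp windowEval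

theorem Λcov_eq_zero_iff (c : FormalRep) : Λcov c = 0 ↔ windowEval c ∈ algReal :=
  QuotientAddGroup.eq_zero_iff _

/-- Rules 1a, 1b preserve the windowed evaluation exactly. -/
theorem windowEval_eq_zero_of_mem_add {c : FormalRep} (hc : c ∈ domainAddRel ∪ integrandAddRel) :
    windowEval c = 0 :=
  closure_add_le_ker_restrictedEval wnd measurableSet_wnd (AddSubgroup.subset_closure hc)

theorem init_apply_zero {k : ℕ} (z : Fin (k + 2) → ℝ) : Fin.init z 0 = z 0 := by
  simp [Fin.init]

/-- **Rule 3) from dimension `k + 2` to `k + 1` preserves the windowed evaluation exactly**: the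
window is a cylinder over the base, so the windowed representations form a Newton–Leibniz
instance themselves and soundness applies. -/
theorem windowEval_nl_succ {k : ℕ} (r : IntegralRep (k + 2)) (r' : IntegralRep (k + 1))
    (a b : (Fin (k + 1) → ℝ) → ℝ) (F : (Fin (k + 2) → ℝ) → ℝ)
    (hF : IsSemialgebraicFunOn ℚ r.domain F)
    (ha : IsSemialgebraicFunOn ℚ r'.domain a) (hb : IsSemialgebraicFunOn ℚ r'.domain b)
    (hab : ∀ x ∈ r'.domain, a x ≤ b x)
    (hdom : r.domain = {z | (Fin.init z : Fin (k + 1) → ℝ) ∈ r'.domain ∧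
      a (Fin.init z) ≤ z (Fin.last (k + 1)) ∧ z (Fin.last (k + 1)) ≤ b (Fin.init z)})
    (hcont : ∀ x ∈ r'.domain, ContinuousOn (fun t : ℝ => F (Fin.snoc x t)) (Icc (a x) (b x)))
    (hderiv : ∀ x ∈ r'.domain, ∀ t ∈ Ioo (a x) (b x),
      HasDerivAt (fun s : ℝ => F (Fin.snoc x s)) (r.integrand (Fin.snoc x t)) t)
    (hbdry : ∀ x ∈ r'.domain, r'.integrand x = F (Fin.snoc x (b x)) - F (Fin.snoc x (a x))) :
    windowEval (of r - of r') = 0 := by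
  have hW : IsSemialgebraic ℚ (r.domain ∩ wnd (k + 2)) :=
    r.isSemialgebraic_domain.inter (isSemialgebraic_wnd _)
  have hW' : IsSemialgebraic ℚ (r'.domain ∩ wnd (k + 1)) :=
    r'.isSemialgebraic_domain.inter (isSemialgebraic_wnd _)
  set rW := r.restrict _ hW inter_subset_left with hrW
  set r'W := r'.restrict _ hW' inter_subset_left with hr'W
  have hmem : of rW - of r'W ∈ newtonLeibnizRel := by
    refine ⟨k + 1, rW, r'W, a, b, F, hF.mono inter_subset_left hW,
      ha.mono inter_subset_left hW', hb.mono inter_subset_left hW', fun x hx => hab x hx.1, ?_,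
      fun x hx => hcont x hx.1, fun x hx t ht => hderiv x hx.1 t ht, fun x hx => hbdry x hx.1, rfl⟩
    ext z
    simp only [hrW, hr'W, IntegralRep.domain_restrict, mem_inter_iff, hdom, mem_setOf_eq, wnd_succ,
      init_apply_zero]
    tauto
  have h0 := eval_eq_zero_of_mem_newtonLeibnizRel_holds hmem
  simp only [map_sub, eval_of, sub_eq_zero] at h0
  rw [map_sub, windowEval_of, windowEval_of, sub_eq_zero]
  exact h0

/-! #### Rule 3) from dimension `1` to `0`: the windowed value is ALGEBRAIC -/

section DimOne

/-- Transfer of set integrals on `ℝ¹` to `ℝ`. -/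
theorem setIntegral_fin_one (g : (Fin 1 → ℝ) → ℝ) (T : Set ℝ) :
    ∫ z in {z : Fin 1 → ℝ | z 0 ∈ T}, g z = ∫ t in T, g (fun _ => t) := by
  have hmp := MeasureTheory.volume_preserving_funUnique (Fin 1) ℝ
  have hpre : {z : Fin 1 → ℝ | z 0 ∈ T} = MeasurableEquiv.funUnique (Fin 1) ℝ ⁻¹' T := by
    ext x; simp [MeasurableEquiv.funUnique, Fin.default_eq_zero]
  have h1 := hmp.setIntegral_preimage_emb (MeasurableEquiv.measurableEmbedding _)
    (fun t => g (fun _ => t)) T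
  rw [hpre, ← h1]
  congr 1
  ext x
  congr 1
  ext i
  simp [MeasurableEquiv.funUnique, Fin.default_eq_zero, Subsingleton.elim i 0]

theorem integrableOn_fin_one {g : (Fin 1 → ℝ) → ℝ} {T : Set ℝ} :
    IntegrableOn g {z : Fin 1 → ℝ | z 0 ∈ T} ↔ IntegrableOn (fun t => g (fun _ => t)) T := by
  have hmp := MeasureTheory.volume_preserving_funUnique (Fin 1) ℝ
  have hpre : {z : Fin 1 → ℝ | z 0 ∈ T} = MeasurableEquiv.funUnique (Fin 1) ℝ ⁻¹' T := by
    ext x; simp [MeasurableEquiv.funUnique, Fin.default_eq_zero]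
  have hcomp : ((fun t => g (fun _ => t)) ∘ MeasurableEquiv.funUnique (Fin 1) ℝ) = g := by
    ext x
    simp only [Function.comp_apply]
    congr 1
    ext i
    simp [MeasurableEquiv.funUnique, Fin.default_eq_zero, Subsingleton.elim i 0]
  rw [hpre]
  conv_lhs => rw [← hcomp]
  exact hmp.integrableOn_comp_preimage (MeasurableEquiv.measurableEmbedding _)

theorem fin_one_eq_const (z : Fin 1 → ℝ) : z = fun _ => z 0 := by
  ext i; rw [Subsingleton.elim i 0]

theorem snoc_fin_zero (x : Fin 0 → ℝ) (s : ℝ) : (Fin.snoc x s : Fin 1 → ℝ) = fun _ => s := by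
  ext i
  have hi : i = Fin.last 0 := Fin.ext (by have := i.isLt; simp only [Fin.val_last]; omega)
  rw [hi]
  simp only [Fin.snoc_last]

/-- `max(a, 0) = (a + |a|)/2` is semialgebraic when `a` is. -/
theorem isSemialgebraicFunOn_max_zero {m : ℕ} {s : Set (Fin m → ℝ)} (hs : IsSemialgebraic ℚ s)
    {a : (Fin m → ℝ) → ℝ} (ha : IsSemialgebraicFunOn ℚ s a) :
    IsSemialgebraicFunOn ℚ s (fun x => max (a x) 0) := by
  have h : IsSemialgebraicFunOn ℚ s (fun x => ((1 / 2 : ℚ) : ℝ) * (a x + |a x|)) :=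
    IsSemialgebraicFunOn.mul_holds (isSemialgebraicFunOn_ratCast hs (1 / 2))
      (IsSemialgebraicFunOn.add_holds ha ha.abs)
  refine h.congr fun x _ => ?_
  simp only
  rcases le_total 0 (a x) with h0 | h0
  · rw [max_eq_left h0, abs_of_nonneg h0]; push_cast; ring
  · rw [max_eq_right h0, abs_of_nonpos h0]; push_cast; ring

/-- `min(b, 1) = (b + 1 − |b − 1|)/2` is semialgebraic when `b` is. -/
theorem isSemialgebraicFunOn_min_one {m : ℕ} {s : Set (Fin m → ℝ)} (hs : IsSemialgebraic ℚ s)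
    {b : (Fin m → ℝ) → ℝ} (hb : IsSemialgebraicFunOn ℚ s b) :
    IsSemialgebraicFunOn ℚ s (fun x => min (b x) 1) := by
  have h1 : IsSemialgebraicFunOn ℚ s (fun x => b x - ((1 : ℚ) : ℝ)) :=
    IsSemialgebraicFunOn.sub_holds hb (isSemialgebraicFunOn_ratCast hs 1)
  have h : IsSemialgebraicFunOn ℚ s
      (fun x => ((1 / 2 : ℚ) : ℝ) * ((b x + ((1 : ℚ) : ℝ)) - |b x - ((1 : ℚ) : ℝ)|)) :=
    IsSemialgebraicFunOn.mul_holds (isSemialgebraicFunOn_ratCast hs (1 / 2))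
      (IsSemialgebraicFunOn.sub_holds (IsSemialgebraicFunOn.add_holds hb (isSemialgebraicFunOn_ratCast hs 1)) h1.abs)
  refine h.congr fun x _ => ?_
  simp only
  rcases le_total (b x) 1 with h0 | h0
  · rw [min_eq_left h0, abs_of_nonpos (by push_cast; linarith)]; push_cast; ring
  · rw [min_eq_right h0, abs_of_nonneg (by push_cast; linarith)]; push_cast; ring

/-- **Rule 3) from dimension `1` to `0` has ALGEBRAIC windowed value.** Over the point, the band is
`[a, b] ⊂ ℝ¹` with `a ≤ b` algebraic, and `∫_{[a,b] ∩ (0,1)} F' = F(min(b,1)) − F(max(a,0))` (or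
`0`) is a difference of values of the `ℚ`-semialgebraic `F` at semialgebraic endpoints — algebraic
numbers (`isAlgebraic_of_isSemialgebraicFunOn_fin_zero`). -/
theorem windowEval_nl_zero (r : IntegralRep 1) (r' : IntegralRep 0)
    (a b : (Fin 0 → ℝ) → ℝ) (F : (Fin 1 → ℝ) → ℝ)
    (hF : IsSemialgebraicFunOn ℚ r.domain F)
    (ha : IsSemialgebraicFunOn ℚ r'.domain a) (hb : IsSemialgebraicFunOn ℚ r'.domain b)
    (hab : ∀ x ∈ r'.domain, a x ≤ b x)
    (hdom : r.domain = {z | (Fin.init z : Fin 0 → ℝ) ∈ r'.domain ∧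
      a (Fin.init z) ≤ z (Fin.last 0) ∧ z (Fin.last 0) ≤ b (Fin.init z)})
    (hcont : ∀ x ∈ r'.domain, ContinuousOn (fun t : ℝ => F (Fin.snoc x t)) (Icc (a x) (b x)))
    (hderiv : ∀ x ∈ r'.domain, ∀ t ∈ Ioo (a x) (b x),
      HasDerivAt (fun s : ℝ => F (Fin.snoc x s)) (r.integrand (Fin.snoc x t)) t) :
    windowEval (of r - of r') ∈ algReal := by
  rw [map_sub, windowEval_of, windowEval_of, wnd_zero, inter_empty, Measure.restrict_empty,
    integral_zero_measure, sub_zero, mem_algReal]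
  rcases (r'.domain).eq_empty_or_nonempty with hτ | ⟨x₀, hx₀⟩
  · -- empty base: empty band
    have hband : r.domain = ∅ := by
      rw [hdom, eq_empty_iff_forall_notMem]
      rintro z ⟨hz, -⟩
      rw [hτ] at hz
      exact hz
    rw [hband, empty_inter, Measure.restrict_empty, integral_zero_measure]
    exact isAlgebraic_zero
  · -- base = the point `x₀`
    have hall : ∀ y : Fin 0 → ℝ, y = x₀ := fun y => Subsingleton.elim y x₀
    set a₀ := a x₀ with ha₀
    set b₀ := b x₀ with hb₀
    set α := max a₀ 0 with hα
    set β := min b₀ 1 with hβ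
    have hab₀ : a₀ ≤ b₀ := hab x₀ hx₀
    -- the band and the windowed band as subsets of `ℝ¹`
    have hband : r.domain = {z : Fin 1 → ℝ | z 0 ∈ Icc a₀ b₀} := by
      rw [hdom]
      ext z
      simp only [mem_setOf_eq, mem_Icc, hall (Fin.init z), hx₀, true_and]
      rfl
    have hset : r.domain ∩ wnd 1 = {z : Fin 1 → ℝ | z 0 ∈ Icc a₀ b₀ ∩ Ioo 0 1} := by
      rw [hband, wnd_succ]
      ext z
      simp only [mem_inter_iff, mem_setOf_eq]
    rw [hset, setIntegral_fin_one]
    -- the one-variable data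
    set G : ℝ → ℝ := fun s => F (Fin.snoc x₀ s) with hG
    set f : ℝ → ℝ := fun t => r.integrand (fun _ => t) with hf
    have hT_sub : Icc a₀ b₀ ∩ Ioo 0 1 ⊆ Icc α β := by
      rintro t ⟨⟨h1, h2⟩, h3, h4⟩
      exact ⟨max_le h1 h3.le, le_min h2 h4.le⟩
    by_cases hαβ : α < β
    · -- non-degenerate window: FTC on `[α, β] ⊆ [a₀, b₀]`
      have hαa : a₀ ≤ α := le_max_left _ _
      have hβb : β ≤ b₀ := min_le_left _ _
      have hIoo_sub : Ioo α β ⊆ Icc a₀ b₀ ∩ Ioo 0 1 := by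
        rintro t ⟨h1, h2⟩
        refine ⟨⟨by linarith, by linarith⟩, ?_, ?_⟩
        · exact lt_of_le_of_lt (le_max_right _ _) h1
        · exact lt_of_lt_of_le h2 (min_le_right _ _)
      have hae : (Icc a₀ b₀ ∩ Ioo 0 1 : Set ℝ) =ᵐ[volume] (Ioo α β : Set ℝ) := by
        refine (ae_eq_set).mpr ⟨?_, ?_⟩
        · refine measure_mono_null (fun t ht => ?_) (Set.Finite.measure_zero (toFinite {α, β}) volume)
          obtain ⟨hT, hnot⟩ := ht
          have ⟨h1, h2⟩ := hT_sub hT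
          simp only [mem_Ioo, not_and_or, not_lt] at hnot
          rcases hnot with h | h
          · exact Or.inl (le_antisymm h h1)
          · exact Or.inr (le_antisymm h2 h)
        · rw [Set.sdiff_eq_empty.mpr hIoo_sub]
          exact measure_empty
      rw [setIntegral_congr_set hae]
      -- FTC
      have hcont' : ContinuousOn G (Icc α β) := by
        refine (hcont x₀ hx₀).mono (Icc_subset_Icc hαa hβb)
      have hderiv' : ∀ t ∈ Ioo α β, HasDerivAt G (f t) t := by
        intro t ht
        have := hderiv x₀ hx₀ t ⟨lt_of_le_of_lt hαa ht.1, lt_of_lt_of_le ht.2 hβb⟩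
        simpa [hG, hf, snoc_fin_zero] using this
      have hint : IntervalIntegrable f volume α β := by
        rw [intervalIntegrable_iff_integrableOn_Ioo_of_le hαβ.le]
        have h1 : IntegrableOn r.integrand {z : Fin 1 → ℝ | z 0 ∈ Ioo α β} := by
          refine r.integrableOn.mono_set ?_
          rw [hband]
          rintro z ⟨h1, h2⟩
          exact ⟨by linarith, by linarith⟩
        exact integrableOn_fin_one.mp h1
      have hFTC := integral_eq_sub_of_hasDerivAt_of_le hαβ.le hcont' hderiv' hint
      rw [integral_of_le hαβ.le, integral_Ioc_eq_integral_Ioo] at hFTC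
      rw [hFTC]
      -- algebraicity of the two endpoint values
      have hτ : IsSemialgebraic ℚ r'.domain := r'.isSemialgebraic_domain
      have hβmem : ∀ y ∈ r'.domain, (Fin.snoc y (min (b y) 1) : Fin 1 → ℝ) ∈ r.domain := by
        intro y _
        rw [hall y, hband]
        simp only [mem_setOf_eq, mem_Icc, snoc_fin_zero]
        refine ⟨?_, min_le_left _ _⟩
        exact le_trans hαa (le_of_lt hαβ)
      have hαmem : ∀ y ∈ r'.domain, (Fin.snoc y (max (a y) 0) : Fin 1 → ℝ) ∈ r.domain := by
        intro y _
        rw [hall y, hband]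
        simp only [mem_setOf_eq, mem_Icc, snoc_fin_zero]
        exact ⟨le_max_left _ _, le_trans (le_of_lt hαβ) hβb⟩
      have hGβ : IsAlgebraic ℚ (G β) := by
        have hsemi := isSemialgebraicFunOn_endpoint hτ (isSemialgebraicFunOn_min_one hτ hb) hF hβmem
        exact isAlgebraic_of_isSemialgebraicFunOn_fin_zero hsemi hx₀
      have hGα : IsAlgebraic ℚ (G α) := by
        have hsemi := isSemialgebraicFunOn_endpoint hτ (isSemialgebraicFunOn_max_zero hτ ha) hF hαmem
        exact isAlgebraic_of_isSemialgebraicFunOn_fin_zero hsemi hx₀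
      exact hGβ.sub hGα
    · -- degenerate window: null set
      have hnull : volume (Icc a₀ b₀ ∩ Ioo 0 1 : Set ℝ) = 0 := by
        refine measure_mono_null hT_sub ?_
        rw [Real.volume_Icc, ENNReal.ofReal_eq_zero]
        linarith [not_lt.mp hαβ]
      rw [Measure.restrict_eq_zero.mpr hnull, integral_zero_measure]
      exact isAlgebraic_zero

end DimOne

/-- Rule 3) shifts the windowed evaluation by an algebraic number. -/
theorem windowEval_mem_algReal_of_mem_newtonLeibnizRel {c : FormalRep} (hc : c ∈ newtonLeibnizRel) :
    windowEval c ∈ algReal := by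
  obtain ⟨k, r, r', a, b, F, hF, ha, hb, hab, hdom, hcont, hderiv, hbdry, rfl⟩ := hc
  cases k with
  | zero => exact windowEval_nl_zero r r' a b F hF ha hb hab hdom hcont hderiv
  | succ k =>
    rw [windowEval_nl_succ r r' a b F hF ha hb hab hdom hcont hderiv hbdry]
    exact algReal.zero_mem

/-- Relations of the sub-calculus without rule 2). -/
def relationsNoCoV : AddSubgroup FormalRep :=
  AddSubgroup.closure (domainAddRel ∪ integrandAddRel ∪ newtonLeibnizRel)

theorem relationsNoCoV_le_relations : relationsNoCoV ≤ relations :=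
  AddSubgroup.closure_mono (union_subset (subset_union_left.trans subset_union_left) subset_union_right)

/-- The crux over the calculus without change of variables. -/
def NormalFormPrincipleWithoutChangeOfVariables : Prop := NormalFormPrincipleMod relationsNoCoV

/-- **Rules 1a, 1b, 3 preserve `Λcov`.** -/
theorem relationsNoCoV_le_ker_Λcov : relationsNoCoV ≤ Λcov.ker := by
  refine (AddSubgroup.closure_le _).mpr ?_
  rintro c (hc | hc)
  · rw [SetLike.mem_coe, AddMonoidHom.mem_ker, Λcov_eq_zero_iff, windowEval_eq_zero_of_mem_add hc]
    exact algReal.zero_mem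
  · rw [SetLike.mem_coe, AddMonoidHom.mem_ker, Λcov_eq_zero_iff]
    exact windowEval_mem_algReal_of_mem_newtonLeibnizRel hc

/-! #### The witness: two arctangent representations of `π/4` -/

/-- The interval `[lo, hi] ⊂ ℝ¹` is `ℚ`-semialgebraic for rational endpoints. -/
theorem isSemialgebraic_Icc_fin_one (lo hi : ℚ) :
    IsSemialgebraic ℚ {z : Fin 1 → ℝ | z 0 ∈ Icc (lo : ℝ) hi} := by
  have h1 := Literature.ModelTheory.ExponentialFields.isSemialgebraic_setOf_eval_le (k := ℚ) (R := ℝ)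
    (MvPolynomial.C lo : MvPolynomial (Fin 1) ℚ) (MvPolynomial.X 0)
  have h2 := Literature.ModelTheory.ExponentialFields.isSemialgebraic_setOf_eval_le (k := ℚ) (R := ℝ)
    (MvPolynomial.X 0 : MvPolynomial (Fin 1) ℚ) (MvPolynomial.C hi)
  simp only [MvPolynomial.aeval_X, MvPolynomial.aeval_C, eq_ratCast] at h1 h2
  have hset : {z : Fin 1 → ℝ | z 0 ∈ Icc (lo : ℝ) hi} =
      {x : Fin 1 → ℝ | (lo : ℝ) ≤ x 0} ∩ {x | x 0 ≤ (hi : ℝ)} := by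
    ext z
    simp [mem_Icc]
  rw [hset]
  exact h1.inter h2

/-- `∫_{[lo,hi]} dt/(1+t²)` as a RATIONAL integral representation on `ℝ¹`. -/
def arctanRep (lo hi : ℚ) : IntegralRep 1 :=
  IntegralRep.ofRational {z : Fin 1 → ℝ | z 0 ∈ Icc (lo : ℝ) hi} 1 (1 + MvPolynomial.X 0 ^ 2)
    (isSemialgebraic_Icc_fin_one lo hi)
    (fun z _ => by
      have : (0:ℝ) < 1 + z 0 ^ 2 := by positivity
      simp only [map_add, map_one, map_pow, MvPolynomial.aeval_X]
      exact this.ne')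
    (by
      have hg : Continuous (fun t : ℝ => 1 / (1 + t ^ 2)) := by
        refine continuous_const.div (by fun_prop) fun t => ?_
        positivity
      have := (hg.integrableOn_Icc (μ := volume) (a := (lo:ℝ)) (b := hi))
      refine ((integrableOn_fin_one (g := fun z : Fin 1 → ℝ => 1 / (1 + z 0 ^ 2))
        (T := Icc (lo:ℝ) hi)).mpr this).congr_fun (fun z _ => ?_)
        ((isSemialgebraic_Icc_fin_one lo hi).measurableSet_holds)
      simp [MvPolynomial.aeval_X] )

theorem arctanRep_domain (lo hi : ℚ) :
    (arctanRep lo hi).domain = {z : Fin 1 → ℝ | z 0 ∈ Icc (lo : ℝ) hi} := rfl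

theorem arctanRep_integrand (lo hi : ℚ) (z : Fin 1 → ℝ) :
    (arctanRep lo hi).integrand z = 1 / (1 + z 0 ^ 2) := by
  simp [arctanRep]

theorem isRational_arctanRep (lo hi : ℚ) : (arctanRep lo hi).IsRational :=
  IntegralRep.isRational_ofRational _ _ _ _ _ _

theorem value_arctanRep {lo hi : ℚ} (h : (lo:ℝ) ≤ hi) :
    (arctanRep lo hi).value = Real.arctan hi - Real.arctan lo := by
  rw [IntegralRep.value, arctanRep_domain]
  simp_rw [arctanRep_integrand]
  rw [setIntegral_fin_one (fun z : Fin 1 → ℝ => 1 / (1 + z 0 ^ 2)) (Icc (lo:ℝ) hi)]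
  simp only
  rw [integral_Icc_eq_integral_Ioc, ← integral_of_le h, integral_one_div_one_add_sq]

theorem windowEval_arctanRep_zero_one : windowEval (of (arctanRep 0 1)) = Real.pi / 4 := by
  rw [windowEval_of, arctanRep_domain, wnd_succ]
  simp_rw [arctanRep_integrand]
  have hset : ({z : Fin 1 → ℝ | z 0 ∈ Icc ((0:ℚ):ℝ) (1:ℚ)} ∩ {x | x 0 ∈ Ioo (0:ℝ) 1}) =
      {z : Fin 1 → ℝ | z 0 ∈ Ioo (0:ℝ) 1} := by
    ext z
    simp only [Rat.cast_zero, Rat.cast_one, mem_inter_iff, mem_setOf_eq, mem_Icc, mem_Ioo]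
    constructor
    · rintro ⟨-, h⟩; exact h
    · rintro ⟨h1, h2⟩; exact ⟨⟨h1.le, h2.le⟩, h1, h2⟩
  rw [hset, setIntegral_fin_one (fun z : Fin 1 → ℝ => 1 / (1 + z 0 ^ 2)) (Ioo (0:ℝ) 1)]
  simp only
  rw [← integral_Ioc_eq_integral_Ioo, ← integral_of_le zero_le_one, integral_one_div_one_add_sq,
    Real.arctan_one, Real.arctan_zero, sub_zero]

theorem windowEval_arctanRep_neg_one_zero : windowEval (of (arctanRep (-1) 0)) = 0 := by
  rw [windowEval_of, arctanRep_domain, wnd_succ]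
  have hset : ({z : Fin 1 → ℝ | z 0 ∈ Icc ((-1:ℚ):ℝ) (0:ℚ)} ∩ {x | x 0 ∈ Ioo (0:ℝ) 1}) = ∅ := by
    ext z
    simp only [Rat.cast_neg, Rat.cast_one, Rat.cast_zero, mem_inter_iff, mem_setOf_eq, mem_Icc,
      mem_Ioo, mem_empty_iff_false, iff_false, not_and, not_lt, and_imp]
    intro _ h2 h3
    linarith
  rw [hset, Measure.restrict_empty, integral_zero_measure]

theorem value_arctanRep_eq : (arctanRep 0 1).value = (arctanRep (-1) 0).value := by
  rw [value_arctanRep (by norm_num), value_arctanRep (by norm_num)]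
  push_cast
  rw [Real.arctan_neg, Real.arctan_zero, Real.arctan_one]
  ring

/-- `π/4` is not algebraic (Lindemann, `transcendental_pi_holds`). -/
theorem pi_div_four_not_mem_algReal : Real.pi / 4 ∉ algReal := by
  intro h
  rw [mem_algReal] at h
  have h4 : IsAlgebraic ℚ ((4 : ℚ) : ℝ) := isAlgebraic_algebraMap (4 : ℚ)
  have hpi : IsAlgebraic ℚ (((4:ℚ):ℝ) * (Real.pi / 4)) := h4.mul h
  have : ((4:ℚ):ℝ) * (Real.pi / 4) = Real.pi := by push_cast; ring
  rw [this] at hpi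
  exact transcendental_pi_holds hpi

theorem Λcov_witness_ne_zero : Λcov (of (arctanRep 0 1) - of (arctanRep (-1) 0)) ≠ 0 := by
  rw [Ne, Λcov_eq_zero_iff, map_sub, windowEval_arctanRep_zero_one,
    windowEval_arctanRep_neg_one_zero, sub_zero]
  exact pi_div_four_not_mem_algReal

/-- `[[0,1], 1/(1+t²)] − [[−1,0], 1/(1+t²)]` is not a relation of the calculus without rule 2). -/
theorem witness_not_mem_relationsNoCoV :
    of (arctanRep 0 1) - of (arctanRep (-1) 0) ∉ relationsNoCoV := fun h =>
  Λcov_witness_ne_zero (relationsNoCoV_le_ker_Λcov h)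


/-- **Any proof of the crux must use rule 2) — even for the reflection `t ↦ −t`.** Over the
sub-calculus generated by both additivity rules and Newton–Leibniz (all dimensions), the crux is
FALSE: `[[0,1], 1/(1+t²)]` and `[[−1,0], 1/(1+t²)]` are rational representations of `π/4`
separated by the invariant `Λcov` = (integral over the first-coordinate window `0 < x₀ < 1`)
mod `ℚ̄ ∩ ℝ`. Ingredients: `KZ.closure_add_le_ker_restrictedEval` (rules 1a/1b), soundness of
rule 3) on the windowed instance (`n + 1 → n ≥ 1`), algebraicity of values of ℚ-semialgebraic
functions over the point (`n = 0`), and Lindemann (`transcendental_pi_holds`).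
SCOPE (honest reading): what is refuted is the sub-calculus `⟨1a, 1b, 3⟩` with rule 3) along the
LAST coordinate as fixed in `KZ.newtonLeibnizRel`; `Λcov` is already killed by the coordinate
transposition `(x₀,x₁) ↦ (x₁,x₀)` (a linear rule-2 move), and indeed the witness pair IS connected
by 1a + 3 + one transposition (paper: `[−1,0]×[0,1]` with integrand `k(s−t)`, `K(x+1) − K(x) =
1/(1+x²)`, `K = x` on `[0,1]`, C¹-continued; Newton–Leibniz in `s`, swap, Newton–Leibniz in `t`) —
consistent with Ayoub's remark that a one-variable change of variables is a combination of Stokes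
elements in two variables [Ayoub2015, Rem. 1.5]. So the load-bearing content isolated here is
"rule 2) at least up to coordinate permutations / rule 3) in every direction", not the non-linear
dilations specifically. -/
theorem normalFormPrinciple_false_without_changeOfVariables :
    ¬ NormalFormPrincipleWithoutChangeOfVariables :=
  not_normalFormPrincipleMod_of_witness (relationsNoCoV_le_relations.trans relations_le_ker)
    (arctanRep 0 1) (arctanRep (-1) 0) (isRational_arctanRep 0 1) (isRational_arctanRep (-1) 0)
    value_arctanRep_eq witness_not_mem_relationsNoCoV

/-- The same witness refutes Conjecture 1 itself over rules 1a, 1b, 3. -/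
theorem not_conjectureMod_relationsNoCoV : ¬ ConjectureMod relationsNoCoV := fun h =>
  witness_not_mem_relationsNoCoV
    (h 1 1 (arctanRep 0 1) (arctanRep (-1) 0) (isRational_arctanRep 0 1)
      (isRational_arctanRep (-1) 0) value_arctanRep_eq)

/-! ### §4.3c Complementarity with the tree's ALGEBRAIC SHADOW (`StuffleInKZ.Negative.AlgebraicShadow`) -/

section Complementarity

open Summit.KontsevichZagierPeriods.Theorems.StuffleInKZ.Negative
  (covFreeRelations HasAlgShadow hasAlgShadow_of_dim_one)

/-- Our no-rule-2 closure IS the tree's `covFreeRelations` (same generators). -/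
theorem relationsNoCoV_eq_covFreeRelations : relationsNoCoV = covFreeRelations := rfl

/-- The arctan reflection pair is a kernel element … -/
theorem eval_arctan_pair : eval (of (arctanRep 0 1) - of (arctanRep (-1) 0)) = 0 := by
  rw [map_sub, eval_of, eval_of, value_arctanRep_eq, sub_self]

/-- … which HAS an algebraic shadow (both representations are one-dimensional; tree
`hasAlgShadow_of_dim_one`) — so the tree's invariant cannot separate it from `covFreeRelations` … -/
theorem hasAlgShadow_arctan_pair : HasAlgShadow (of (arctanRep 0 1) - of (arctanRep (-1) 0)) := by
  rw [sub_eq_add_neg]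
  exact (hasAlgShadow_of_dim_one (arctanRep 0 1)).add (hasAlgShadow_of_dim_one (arctanRep (-1) 0)).neg

/-- … whereas `Λcov` does: **the algebraic shadow does not characterise `covFreeRelations`**, and
the two invariants (functional transcendence of the marginal vs arithmetic of the windowed value)
are complementary. -/
theorem exists_kernel_algShadow_not_mem_covFreeRelations :
    ∃ c : FormalRep, eval c = 0 ∧ HasAlgShadow c ∧ c ∉ covFreeRelations :=
  ⟨_, eval_arctan_pair, hasAlgShadow_arctan_pair,
    relationsNoCoV_eq_covFreeRelations ▸ witness_not_mem_relationsNoCoV⟩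

end Complementarity


/-! ### §4.3b The no-rule-2 witness is reconnected by two Newton–Leibniz moves and ONE transposition

REMARK (the general mechanism, for planners; Ayoub's homotopy formula [Ayoub2015, Rem. 1.5]). For a
one-variable change of variables `u = ψ(t)` (`ψ` semialgebraic C¹ on `[0,1]`, `ψ(0)=0`, `ψ(1)=1`) and
an algebraic integrand `f` with ANY (transcendental) primitive `F`, put `u(t,s) = t + s(ψ(t) − t)` and
`g := ∂ₜ∂ₛ F(u) = f′(u) ∂ₜu ∂ₛu + f(u) ∂ₜ∂ₛu` — ALGEBRAIC. Its primitive in `s` is `∂ₜF(u) = f(u)∂ₜu`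
and in `t` is `∂ₛF(u) = f(u)(ψ(t) − t)`, both algebraic; Newton–Leibniz in `s` over `t ∈ [0,1]` gives
`[f(ψ)ψ′] − [f]`-type boundary data, Newton–Leibniz in `t` (after ONE swap) gives `0` (edges
`ψ(0)=0`, `ψ(1)=1`). So every one-variable rule-2 identity is generated by rules 1, 3 and a
transposition; the scaling `t ↦ 2t` for `1/(1+u²)` is the instance `g = Φ′(ts)`, `Φ(u) = u/(1+u²)`
(primitives `Φ(ts)/t = s/(1+t²s²)` and `Φ(ts)/s`), the reflection below is `k(s − t)`. CONJECTURE
(structural, positive, not attempted here): `relations = closure (domainAddRel ∪ newtonLeibnizRel ∪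
{coordinate permutations})` — the load-bearing content of rule 2) modulo rule 3) would be exactly the
permutations (multi-variable maps by triangular decomposition). A route could take this as a
simplification target of the H21 calculus. -/

section Swap

/-- The C¹ difference-equation solution `K`: `K(u) = u` on `u ≤ 1`, `K(u) = (u−1) + 1/(1+(u−1)²)`
on `u ≥ 1`; it satisfies `K(x+1) − K(x) = 1/(1+x²)` for `x ∈ [0,1]`. -/
def Kfun (u : ℝ) : ℝ := if u ≤ 1 then u else (u - 1) + (1 + (u - 1) ^ 2)⁻¹

/-- Its derivative `k = K'`: `1` on `u ≤ 1`, `1 − 2(u−1)/(1+(u−1)²)²` on `u ≥ 1` (continuous at `1`). -/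
def kfun (u : ℝ) : ℝ := if u ≤ 1 then 1 else 1 + (-(2 * (u - 1)) / (1 + (u - 1) ^ 2) ^ 2)

/-- `1 + y² > 0`. -/
theorem one_add_sq_pos (y : ℝ) : 0 < 1 + y ^ 2 := by positivity

/-- Derivative of the rational piece `u ↦ (u−1) + 1/(1+(u−1)²)`. -/
theorem hasDerivAt_ratPiece (u : ℝ) :
    HasDerivAt (fun u : ℝ => (u - 1) + (1 + (u - 1) ^ 2)⁻¹)
      (1 + (-(2 * (u - 1)) / (1 + (u - 1) ^ 2) ^ 2)) u := by
  have hq : HasDerivAt (fun u : ℝ => 1 + (u - 1) ^ 2) (2 * (u - 1)) u := by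
    have h := (((hasDerivAt_id u).sub_const 1).pow 2).const_add 1
    have e : (2 * (u - 1) : ℝ) = ↑(2:ℕ) * (id u - 1) ^ (2 - 1) * 1 := by simp
    rw [e]
    exact h
  exact ((hasDerivAt_id u).sub_const 1).add (hq.inv (one_add_sq_pos (u - 1)).ne')

/-- `K' = k` everywhere (C¹ junction at `u = 1`: both one-sided derivatives equal `1`). -/
theorem hasDerivAt_Kfun (u : ℝ) : HasDerivAt Kfun (kfun u) u := by
  unfold Kfun kfun
  rcases lt_trichotomy u 1 with hu | rfl | hu
  · have hev : (fun u : ℝ => if u ≤ 1 then u else (u - 1) + (1 + (u - 1) ^ 2)⁻¹) =ᶠ[nhds u] id := by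
      filter_upwards [Iio_mem_nhds hu] with v hv
      have hv' : v < 1 := hv
      simp [hv'.le]
    rw [if_pos hu.le]
    exact (hasDerivAt_id u).congr_of_eventuallyEq hev
  · rw [if_pos le_rfl]
    have hleft : HasDerivWithinAt (fun u : ℝ => if u ≤ 1 then u else (u - 1) + (1 + (u - 1) ^ 2)⁻¹)
        1 (Iic 1) 1 :=
      ((hasDerivAt_id (1:ℝ)).hasDerivWithinAt (s := Iic 1)).congr
        (fun v hv => by simp [show v ≤ 1 from hv]) (by simp)
    have hright : HasDerivWithinAt (fun u : ℝ => if u ≤ 1 then u else (u - 1) + (1 + (u - 1) ^ 2)⁻¹)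
        1 (Ici 1) 1 := by
      have h := (hasDerivAt_ratPiece 1).hasDerivWithinAt (s := Ici 1)
      simp only [sub_self, mul_zero, neg_zero, zero_div, add_zero] at h
      refine h.congr (fun v hv => ?_) (by simp)
      by_cases hv1 : v ≤ 1
      · have : v = 1 := le_antisymm hv1 hv
        subst this; simp
      · simp [hv1]
    have := hleft.union hright
    rw [Iic_union_Ici] at this
    exact this.hasDerivAt Filter.univ_mem
  · have hev : (fun u : ℝ => if u ≤ 1 then u else (u - 1) + (1 + (u - 1) ^ 2)⁻¹) =ᶠ[nhds u]
        fun u => (u - 1) + (1 + (u - 1) ^ 2)⁻¹ := by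
      filter_upwards [Ioi_mem_nhds hu] with v hv
      have hv' : 1 < v := hv
      simp [not_le.mpr hv']
    rw [if_neg (not_le.mpr hu)]
    exact (hasDerivAt_ratPiece u).congr_of_eventuallyEq hev

/-- `K` is continuous (the pieces agree at `u = 1`). -/
theorem continuous_Kfun : Continuous Kfun := by
  unfold Kfun
  refine Continuous.if_le continuous_id ?_ continuous_id continuous_const ?_
  · exact (continuous_id.sub continuous_const).add
      ((continuous_const.add ((continuous_id.sub continuous_const).pow 2)).inv₀
        fun u => (one_add_sq_pos (u - 1)).ne')
  · intro u hu; simp [hu]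

/-- `k` is continuous (the pieces agree at `u = 1`). -/
theorem continuous_kfun : Continuous kfun := by
  unfold kfun
  refine Continuous.if_le continuous_const ?_ continuous_id continuous_const ?_
  · refine continuous_const.add (Continuous.div ?_ ?_ fun u => ?_)
    · fun_prop
    · fun_prop
    · exact (pow_pos (one_add_sq_pos (u - 1)) 2).ne'
  · intro u hu; simp [hu]

/-- The functional equation `K(x+1) − K(x) = 1/(1+x²)` on `[0,1]`. -/
theorem Kfun_add_one_sub (x : ℝ) (h0 : 0 ≤ x) (h1 : x ≤ 1) : Kfun (x + 1) - Kfun x = 1 / (1 + x ^ 2) := by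
  unfold Kfun
  rw [if_pos h1]
  by_cases hx : x + 1 ≤ 1
  · have hx0 : x = 0 := le_antisymm (by linarith) h0
    subst hx0; simp
  · rw [if_neg hx]
    have : (x + 1 - 1 : ℝ) = x := by ring
    rw [this, one_div]
    ring

/-! #### The two-dimensional representation `A = [[−1,0]×[0,1], k(s − t)]` (coordinates `(t,s)`) -/

/-- The rectangle `[−1,0] × [0,1] ⊂ ℝ²` (first coordinate `t`, last coordinate `s`). -/
def rectTS : Set (Fin 2 → ℝ) := {z | z 0 ∈ Icc (-1:ℝ) 0 ∧ z 1 ∈ Icc (0:ℝ) 1}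

/-- The rectangle as an order interval of `ℝ²`. -/
theorem rectTS_eq_Icc : rectTS = Icc ![(-1:ℝ), 0] ![0, 1] := by
  ext z
  simp only [rectTS, mem_setOf_eq, mem_Icc, Pi.le_def, Fin.forall_fin_two, Matrix.cons_val_zero,
    Matrix.cons_val_one]
  tauto

/-- The rectangle is compact. -/
theorem isCompact_rectTS : IsCompact rectTS := by
  rw [rectTS_eq_Icc]; exact isCompact_Icc

/-- Polynomial (in)equalities in `ℝ²` are `ℚ`-semialgebraic — the four faces and the diagonal cut. -/
theorem isSemialgebraic_rectTS : IsSemialgebraic ℚ rectTS := by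
  have h1 := Literature.ModelTheory.ExponentialFields.isSemialgebraic_setOf_eval_le (k := ℚ) (R := ℝ)
    (MvPolynomial.C (-1) : MvPolynomial (Fin 2) ℚ) (MvPolynomial.X 0)
  have h2 := Literature.ModelTheory.ExponentialFields.isSemialgebraic_setOf_eval_le (k := ℚ) (R := ℝ)
    (MvPolynomial.X 0 : MvPolynomial (Fin 2) ℚ) 0
  have h3 := Literature.ModelTheory.ExponentialFields.isSemialgebraic_setOf_eval_le (k := ℚ) (R := ℝ)
    (0 : MvPolynomial (Fin 2) ℚ) (MvPolynomial.X 1)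
  have h4 := Literature.ModelTheory.ExponentialFields.isSemialgebraic_setOf_eval_le (k := ℚ) (R := ℝ)
    (MvPolynomial.X 1 : MvPolynomial (Fin 2) ℚ) 1
  simp only [MvPolynomial.aeval_X, map_zero, map_one, map_neg] at h1 h2 h3 h4
  have hset : rectTS = (({z : Fin 2 → ℝ | (-1:ℝ) ≤ z 0} ∩ {z | z 0 ≤ 0}) ∩ {z | (0:ℝ) ≤ z 1}) ∩ {z | z 1 ≤ 1} := by
    ext z; simp [rectTS, mem_Icc, and_assoc]
  rw [hset]
  exact ((h1.inter h2).inter h3).inter h4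

/-- The half-plane `z i − z j ≤ 1` is `ℚ`-semialgebraic. -/
theorem isSemialgebraic_diag_le (i j : Fin 2) : IsSemialgebraic ℚ {z : Fin 2 → ℝ | z i - z j ≤ 1} := by
  have h := Literature.ModelTheory.ExponentialFields.isSemialgebraic_setOf_eval_le (k := ℚ) (R := ℝ)
    (MvPolynomial.X i - MvPolynomial.X j : MvPolynomial (Fin 2) ℚ) 1
  simpa using h

/-- The half-plane `z i − z j ≥ 1` is `ℚ`-semialgebraic. -/
theorem isSemialgebraic_diag_ge (i j : Fin 2) : IsSemialgebraic ℚ {z : Fin 2 → ℝ | 1 ≤ z i - z j} := by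
  have h := Literature.ModelTheory.ExponentialFields.isSemialgebraic_setOf_eval_le (k := ℚ) (R := ℝ)
    (1 : MvPolynomial (Fin 2) ℚ) (MvPolynomial.X i - MvPolynomial.X j)
  simpa using h

/-- A piecewise-rational function of `u = z 1 − z 0`, glued along `u = 1`, is `ℚ`-semialgebraic
on any `ℚ`-semialgebraic `s ⊆ ℝ²`. Pieces: a polynomial `P(u)` on `u ≤ 1` and `Q(u) + c/(1+(u−1)²)ᵉ`
type expressions are handled by `isSemialgebraicFunOn_aeval_div_aeval`. We state the two cases
we need. -/
theorem isSemialgebraicFunOn_Kfun_comp {s : Set (Fin 2 → ℝ)} (hs : IsSemialgebraic ℚ s) (i j : Fin 2) :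
    IsSemialgebraicFunOn ℚ s (fun z => Kfun (z i - z j)) := by
  have hA : IsSemialgebraicFunOn ℚ (s ∩ {z : Fin 2 → ℝ | z i - z j ≤ 1}) (fun z => z i - z j) := by
    have := isSemialgebraicFunOn_aeval (hs.inter (isSemialgebraic_diag_le i j))
      (MvPolynomial.X i - MvPolynomial.X j : MvPolynomial (Fin 2) ℚ)
    exact this.congr fun z _ => by simp
  have hB : IsSemialgebraicFunOn ℚ (s ∩ {z : Fin 2 → ℝ | 1 ≤ z i - z j})
      (fun z => (z i - z j - 1) + (1 + (z i - z j - 1) ^ 2)⁻¹) := by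
    set u : MvPolynomial (Fin 2) ℚ := MvPolynomial.X i - MvPolynomial.X j - 1 with hu
    have hq : ∀ z ∈ s ∩ {z : Fin 2 → ℝ | 1 ≤ z i - z j}, MvPolynomial.aeval z (1 + u ^ 2) ≠ 0 := by
      intro z _
      have : (0:ℝ) < 1 + (z i - z j - 1) ^ 2 := one_add_sq_pos _
      simp only [hu, map_add, map_one, map_pow, map_sub, MvPolynomial.aeval_X]
      exact this.ne'
    have := isSemialgebraicFunOn_aeval_div_aeval (hs.inter (isSemialgebraic_diag_ge i j))
      (u * (1 + u ^ 2) + 1) (1 + u ^ 2) hq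
    refine this.congr fun z _ => ?_
    have hpos : (1 + (z i - z j - 1) ^ 2 : ℝ) ≠ 0 := (one_add_sq_pos _).ne'
    simp only [hu, map_add, map_one, map_pow, map_sub, map_mul, MvPolynomial.aeval_X]
    field_simp
  have hunion : s = (s ∩ {z : Fin 2 → ℝ | z i - z j ≤ 1}) ∪ (s ∩ {z : Fin 2 → ℝ | 1 ≤ z i - z j}) := by
    rw [← inter_union_distrib_left]
    refine (inter_eq_left.mpr fun z _ => ?_).symm
    exact (le_total (z i - z j) 1).imp id id
  rw [hunion]
  refine IsSemialgebraicFunOn.union hA hB (fun z hz => ?_) (fun z hz => ?_)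
  · have : z i - z j ≤ 1 := hz.2
    simp [Kfun, this]
  · have h1 : 1 ≤ z i - z j := hz.2
    by_cases h : z i - z j ≤ 1
    · have heq : z i - z j = 1 := le_antisymm h h1
      simp [Kfun, heq]
    · simp [Kfun, h]

/-- `z ↦ k(z i − z j)` is `ℚ`-semialgebraic (piecewise rational, glued along `z i − z j = 1`). -/
theorem isSemialgebraicFunOn_kfun_comp {s : Set (Fin 2 → ℝ)} (hs : IsSemialgebraic ℚ s) (i j : Fin 2) :
    IsSemialgebraicFunOn ℚ s (fun z => kfun (z i - z j)) := by
  have hA : IsSemialgebraicFunOn ℚ (s ∩ {z : Fin 2 → ℝ | z i - z j ≤ 1}) (fun _ => ((1:ℚ) : ℝ)) :=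
    isSemialgebraicFunOn_ratCast (hs.inter (isSemialgebraic_diag_le i j)) 1
  have hB : IsSemialgebraicFunOn ℚ (s ∩ {z : Fin 2 → ℝ | 1 ≤ z i - z j})
      (fun z => 1 + (-(2 * (z i - z j - 1)) / (1 + (z i - z j - 1) ^ 2) ^ 2)) := by
    set u : MvPolynomial (Fin 2) ℚ := MvPolynomial.X i - MvPolynomial.X j - 1 with hu
    have hq : ∀ z ∈ s ∩ {z : Fin 2 → ℝ | 1 ≤ z i - z j}, MvPolynomial.aeval z ((1 + u ^ 2) ^ 2) ≠ 0 := by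
      intro z _
      have : (0:ℝ) < (1 + (z i - z j - 1) ^ 2) ^ 2 := pow_pos (one_add_sq_pos _) 2
      simp only [hu, map_add, map_one, map_pow, map_sub, MvPolynomial.aeval_X]
      exact this.ne'
    have := isSemialgebraicFunOn_aeval_div_aeval (hs.inter (isSemialgebraic_diag_ge i j))
      ((1 + u ^ 2) ^ 2 - 2 * u) ((1 + u ^ 2) ^ 2) hq
    refine this.congr fun z _ => ?_
    have hpos : ((1 + (z i - z j - 1) ^ 2) ^ 2 : ℝ) ≠ 0 := (pow_pos (one_add_sq_pos _) 2).ne'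
    simp only [hu, map_add, map_one, map_pow, map_sub, map_mul, MvPolynomial.aeval_X, map_ofNat]
    field_simp
    ring
  have hunion : s = (s ∩ {z : Fin 2 → ℝ | z i - z j ≤ 1}) ∪ (s ∩ {z : Fin 2 → ℝ | 1 ≤ z i - z j}) := by
    rw [← inter_union_distrib_left]
    refine (inter_eq_left.mpr fun z _ => ?_).symm
    exact (le_total (z i - z j) 1).imp id id
  rw [hunion]
  refine IsSemialgebraicFunOn.union hA hB (fun z hz => ?_) (fun z hz => ?_)
  · have : z i - z j ≤ 1 := hz.2
    simp [kfun, this]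
  · have h1 : 1 ≤ z i - z j := hz.2
    by_cases h : z i - z j ≤ 1
    · have heq : z i - z j = 1 := le_antisymm h h1
      simp [kfun, heq]
    · simp [kfun, h]

/-- **The bridge representation** `A = [[−1,0] × [0,1], k(s − t)]`, coordinates `(t, s)`. -/
def bridgeRep : IntegralRep 2 where
  domain := rectTS
  integrand z := kfun (z 1 - z 0)
  isSemialgebraic_domain := isSemialgebraic_rectTS
  isSemialgebraicFunOn_integrand := isSemialgebraicFunOn_kfun_comp isSemialgebraic_rectTS 1 0
  integrableOn := by
    refine ContinuousOn.integrableOn_compact isCompact_rectTS ?_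
    exact (continuous_kfun.comp ((continuous_apply 1).sub (continuous_apply 0))).continuousOn

/-- `Fin.init` on `ℝ²` keeps the first coordinate. -/
theorem init_fin_two (z : Fin 2 → ℝ) : (Fin.init z : Fin 1 → ℝ) 0 = z 0 := rfl

/-- First coordinate of `Fin.snoc x s : ℝ²`. -/
theorem snoc_fin_one_zero (x : Fin 1 → ℝ) (s : ℝ) : (Fin.snoc x s : Fin 2 → ℝ) 0 = x 0 := by
  have : (0 : Fin 2) = Fin.castSucc (0 : Fin 1) := rfl
  rw [this, Fin.snoc_castSucc]

/-- Last coordinate of `Fin.snoc x s : ℝ²`. -/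
theorem snoc_fin_one_one (x : Fin 1 → ℝ) (s : ℝ) : (Fin.snoc x s : Fin 2 → ℝ) 1 = s := by
  have : (1 : Fin 2) = Fin.last 1 := rfl
  rw [this, Fin.snoc_last]

/-- **Move 1 (Newton–Leibniz in `s`)**: `[A] − [[−1,0], 1/(1+t²)]` is ONE rule-3 move, primitive
`K(s − t)`, edges `0 ≤ 1`, boundary `K(1−t) − K(−t) = 1/(1+t²)`. -/
theorem of_bridgeRep_sub_mem_newtonLeibnizRel :
    of bridgeRep - of (arctanRep (-1) 0) ∈ newtonLeibnizRel := by
  refine ⟨1, bridgeRep, arctanRep (-1) 0, fun _ => 0, fun _ => 1, fun z => Kfun (z 1 - z 0),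
    isSemialgebraicFunOn_Kfun_comp isSemialgebraic_rectTS 1 0, ?_, ?_, fun _ _ => zero_le_one, ?_, ?_, ?_, ?_, rfl⟩
  · exact (isSemialgebraicFunOn_ratCast (arctanRep (-1) 0).isSemialgebraic_domain 0).congr fun _ _ => by simp
  · exact (isSemialgebraicFunOn_ratCast (arctanRep (-1) 0).isSemialgebraic_domain 1).congr fun _ _ => by simp
  · ext z
    simp only [bridgeRep, rectTS, arctanRep_domain, mem_setOf_eq, mem_Icc, Rat.cast_neg, Rat.cast_one,
      Rat.cast_zero, init_fin_two]
    rfl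
  · intro x _
    simp only [snoc_fin_one_zero, snoc_fin_one_one]
    exact (continuous_Kfun.comp (continuous_id.sub continuous_const)).continuousOn
  · intro x _ s _
    simp only [bridgeRep, snoc_fin_one_zero, snoc_fin_one_one]
    have h := (hasDerivAt_Kfun (s - x 0)).comp s ((hasDerivAt_id s).sub_const (x 0))
    rw [mul_one] at h
    exact h
  · intro x hx
    rw [arctanRep_integrand]
    simp only [snoc_fin_one_zero, snoc_fin_one_one]
    have hx' : x 0 ∈ Icc (-1:ℝ) 0 := by simpa [arctanRep_domain] using hx
    have h := Kfun_add_one_sub (-x 0) (by linarith [hx'.2]) (by linarith [hx'.1])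
    have e1 : (1:ℝ) - x 0 = -x 0 + 1 := by ring
    have e2 : (0:ℝ) - x 0 = -x 0 := by ring
    rw [e1, e2, h]
    ring

/-- The transposed bridge `B = A.reindex swap = [[0,1] × [−1,0], k(s − t)]`, coordinates `(s, t)`. -/
def bridgeRepSwap : IntegralRep 2 := bridgeRep.reindex (Equiv.swap 0 1)

/-- The domain of the transposed bridge is `[0,1] × [−1,0]` (coordinates `(s,t)`). -/
theorem bridgeRepSwap_domain :
    bridgeRepSwap.domain = {w : Fin 2 → ℝ | w 1 ∈ Icc (-1:ℝ) 0 ∧ w 0 ∈ Icc (0:ℝ) 1} := by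
  ext w
  simp [bridgeRepSwap, IntegralRep.reindex_domain, bridgeRep, rectTS, Equiv.swap_apply_left,
    Equiv.swap_apply_right]

/-- The integrand of the transposed bridge is `k(s − t)`. -/
theorem bridgeRepSwap_integrand (w : Fin 2 → ℝ) : bridgeRepSwap.integrand w = kfun (w 0 - w 1) := by
  simp [bridgeRepSwap, IntegralRep.reindex_integrand, bridgeRep, Equiv.swap_apply_left, Equiv.swap_apply_right]

/-- **Move 3 (Newton–Leibniz in `t`, now the last coordinate)**: `[B] − [[0,1], 1/(1+s²)]` is ONE
rule-3 move, primitive `−K(s − t)`, edges `−1 ≤ 0`, boundary `K(s+1) − K(s) = 1/(1+s²)`. -/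
theorem of_bridgeRepSwap_sub_mem_newtonLeibnizRel :
    of bridgeRepSwap - of (arctanRep 0 1) ∈ newtonLeibnizRel := by
  have hdomS : IsSemialgebraic ℚ bridgeRepSwap.domain := bridgeRepSwap.isSemialgebraic_domain
  refine ⟨1, bridgeRepSwap, arctanRep 0 1, fun _ => -1, fun _ => 0, fun w => -Kfun (w 0 - w 1),
    ?_, ?_, ?_, fun _ _ => by norm_num, ?_, ?_, ?_, ?_, rfl⟩
  · exact (isSemialgebraicFunOn_Kfun_comp hdomS 0 1).neg
  · exact (isSemialgebraicFunOn_ratCast (arctanRep 0 1).isSemialgebraic_domain (-1)).congr fun _ _ => by simp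
  · exact (isSemialgebraicFunOn_ratCast (arctanRep 0 1).isSemialgebraic_domain 0).congr fun _ _ => by simp
  · ext w
    simp only [bridgeRepSwap_domain, arctanRep_domain, mem_setOf_eq, mem_Icc, Rat.cast_zero, Rat.cast_one,
      init_fin_two]
    constructor
    · rintro ⟨⟨h1, h2⟩, h3⟩; exact ⟨h3, h1, h2⟩
    · rintro ⟨h3, h1, h2⟩; exact ⟨⟨h1, h2⟩, h3⟩
  · intro x _
    simp only [snoc_fin_one_zero, snoc_fin_one_one]
    exact (continuous_Kfun.comp (continuous_const.sub continuous_id)).neg.continuousOn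
  · intro x _ t _
    rw [bridgeRepSwap_integrand]
    simp only [snoc_fin_one_zero, snoc_fin_one_one]
    have h := (hasDerivAt_Kfun (x 0 - t)).comp t ((hasDerivAt_const t (x 0)).sub (hasDerivAt_id t))
    have h' := h.neg
    have e : -(kfun (x 0 - t) * (0 - 1)) = kfun (x 0 - t) := by ring
    rw [e] at h'
    exact h'
  · intro x hx
    rw [arctanRep_integrand]
    simp only [snoc_fin_one_zero, snoc_fin_one_one]
    have hx' : x 0 ∈ Icc (0:ℝ) 1 := by simpa [arctanRep_domain] using hx
    have h := Kfun_add_one_sub (x 0) hx'.1 hx'.2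
    have e1 : x 0 - (0:ℝ) = x 0 := by ring
    have e2 : x 0 - (-1:ℝ) = x 0 + 1 := by ring
    rw [e1, e2, ← h]
    ring

/-- **Move 2 (ONE transposition)**: `[A] − [B]` is a single change-of-variables move along the
coordinate swap (linear, `|det| = 1`; the instance of `KZ.of_sub_of_reindex_mem_relations`). -/
theorem of_bridgeRep_sub_swap_mem_changeOfVariablesRel :
    of bridgeRep - of bridgeRepSwap ∈ changeOfVariablesRel := by
  let e : Fin 2 ≃ Fin 2 := Equiv.swap 0 1
  let M : Matrix (Fin 2) (Fin 2) ℝ := (1 : Matrix (Fin 2) (Fin 2) ℝ).submatrix e.symm (Equiv.refl _)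
  let L : (Fin 2 → ℝ) →L[ℝ] (Fin 2 → ℝ) := LinearMap.toContinuousLinearMap (Matrix.toLin' M)
  have hL : ∀ z : Fin 2 → ℝ, L z = fun j => z (e.symm j) := by
    intro z
    change Matrix.toLin' M z = _
    rw [Matrix.toLin'_apply, Matrix.submatrix_mulVec_equiv, Matrix.one_mulVec]
    rfl
  have hdet : |L.det| = 1 := by
    change |LinearMap.det (Matrix.toLin' M)| = 1
    rw [LinearMap.det_toLin', Matrix.abs_det_submatrix_equiv_equiv, Matrix.det_one, abs_one]
  refine ⟨2, bridgeRep, bridgeRepSwap, fun z => fun j => z (e.symm j), fun _ => L, ?_, ?_, ?_, ?_, ?_, rfl⟩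
  · convert isSemialgebraicMapOn_aeval bridgeRep.isSemialgebraic_domain
      (fun j => (MvPolynomial.X (e.symm j) : MvPolynomial (Fin 2) ℚ)) using 2 with z
    ext j; simp
  · intro z _
    have h := L.hasFDerivWithinAt (s := bridgeRep.domain) (x := z)
    convert h using 1
    ext z' j
    rw [hL]
  · intro z₁ _ z₂ _ h
    ext i
    have := congrFun h (e i)
    simpa [e] using this
  · ext w
    simp only [bridgeRepSwap, IntegralRep.reindex_domain, mem_setOf_eq, mem_image]
    constructor
    · intro hw
      exact ⟨fun i => w (e i), hw, by ext j; simp [e]⟩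
    · rintro ⟨z, hz, rfl⟩
      simpa [e] using hz
  · intro z _
    rw [hdet, mul_one]
    simp [bridgeRepSwap, IntegralRep.reindex_integrand, e]

/-- **Three moves reconnect the no-rule-2 witness**: `[[−1,0], f] − [[0,1], f]`, `f = 1/(1+t²)`,
lies in the subgroup generated by rule 3) together with the SINGLE transposition instance
`[A] − [B]` (so `Λcov` dies under one coordinate permutation, and the pair is KZ-equivalent).
Identity: `r₋ − r₊ = −(A − r₋) + (A − B) + (B − r₊)`. -/
theorem arctan_pair_mem_closure_nl_swap :
    of (arctanRep (-1) 0) - of (arctanRep 0 1) ∈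
      AddSubgroup.closure (newtonLeibnizRel ∪ {of bridgeRep - of bridgeRepSwap}) := by
  set S := AddSubgroup.closure (newtonLeibnizRel ∪ {of bridgeRep - of bridgeRepSwap})
  have e1 : of bridgeRep - of (arctanRep (-1) 0) ∈ S :=
    AddSubgroup.subset_closure (Or.inl of_bridgeRep_sub_mem_newtonLeibnizRel)
  have e2 : of bridgeRep - of bridgeRepSwap ∈ S := AddSubgroup.subset_closure (Or.inr rfl)
  have e3 : of bridgeRepSwap - of (arctanRep 0 1) ∈ S :=
    AddSubgroup.subset_closure (Or.inl of_bridgeRepSwap_sub_mem_newtonLeibnizRel)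
  have : of (arctanRep (-1) 0) - of (arctanRep 0 1) =
      -(of bridgeRep - of (arctanRep (-1) 0)) + (of bridgeRep - of bridgeRepSwap)
        + (of bridgeRepSwap - of (arctanRep 0 1)) := by abel
  rw [this]
  exact S.add_mem (S.add_mem (S.neg_mem e1) e2) e3

/-- In particular the two arctangent representations ARE equivalent in the full calculus. -/
theorem arctan_pair_equivalent : Equivalent (arctanRep (-1) 0) (arctanRep 0 1) := by
  refine AddSubgroup.closure_le (K := relations) |>.mpr ?_ arctan_pair_mem_closure_nl_swap
  rintro c (hc | hc)
  · exact newtonLeibnizRel_subset_relations hc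
  · rw [mem_singleton_iff] at hc
    subst hc
    exact changeOfVariablesRel_subset_relations of_bridgeRep_sub_swap_mem_changeOfVariablesRel

end Swap

/-! ### §4.4 Without domain additivity only (rules 1b, 2, 3): FALSE on paper -/

/-- Relations of the sub-calculus without rule 1a). -/
def relationsNoDomainAdd : AddSubgroup FormalRep :=
  AddSubgroup.closure (integrandAddRel ∪ changeOfVariablesRel ∪ newtonLeibnizRel)

/-- **NEAR-MISS (paper only).** Over rules 1b, 2, 3 the crux is false: the invariant
`J_g [σ, f] := g(χ(σ)) · ∫_σ f` (`χ` the o-minimal Euler characteristic of the ℚ-semialgebraic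
set `σ`, `g : ℤ → ℤ` arbitrary) is preserved by 1b (same domain), by 2 (a change of variables is
a continuous definable bijection `σ → Φ '' σ`, and `χ` is invariant under definable bijections,
van den Dries 1998 Ch. 4 (2.4)), and by 3 (a band with closed non-empty fibres `[a x, b x]` has
`χ(band) = χ(τ)`, o-minimal Fubini for `χ`; values agree by soundness), but NOT by 1a; witness
`[(0,1), 1]` (`χ = −1`) against `[[0,1], 1]` (`χ = 1`), both rational of value `1`, `g = 𝟙_{1}`.
So rule 1a is load-bearing exactly for discarding null sets (endpoints, faces). Not formalisable
now: Mathlib has no o-minimal Euler characteristic. -/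
theorem normalFormPrinciple_false_without_domainAdd :
    ¬ NormalFormPrincipleMod relationsNoDomainAdd := by
  sorry

/-! ### §4.5 Integrand additivity is a DERIVED rule of domain additivity + Newton–Leibniz -/

/-- The C¹ smoothstep `φ(t) = 3t² − 2t³`: `φ(0) = 0`, `φ(1) = 1`, `φ'(0) = φ'(1) = 0`. -/
def sstep (t : ℝ) : ℝ := 3 * t ^ 2 - 2 * t ^ 3

/-- Its derivative `φ'(t) = 6t − 6t²`. -/
def dsstep (t : ℝ) : ℝ := 6 * t - 6 * t ^ 2

@[simp] theorem sstep_zero : sstep 0 = 0 := by simp [sstep]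
@[simp] theorem sstep_one : sstep 1 = 1 := by norm_num [sstep]
@[simp] theorem dsstep_zero : dsstep 0 = 0 := by simp [dsstep]
@[simp] theorem dsstep_one : dsstep 1 = 0 := by norm_num [dsstep]

theorem hasDerivAt_sstep (t : ℝ) : HasDerivAt sstep (dsstep t) t := by
  have h1 : HasDerivAt (fun s : ℝ => 3 * s ^ 2) (3 * (↑(2:ℕ) * t ^ (2 - 1))) t :=
    (hasDerivAt_pow 2 t).const_mul 3
  have h2 : HasDerivAt (fun s : ℝ => 2 * s ^ 3) (2 * (↑(3:ℕ) * t ^ (3 - 1))) t :=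
    (hasDerivAt_pow 3 t).const_mul 2
  have h := h1.sub h2
  have e : dsstep t = 3 * (↑(2:ℕ) * t ^ (2 - 1)) - 2 * (↑(3:ℕ) * t ^ (3 - 1)) := by
    simp [dsstep]; ring
  rw [e]
  exact h

theorem hasDerivAt_sstep_sub (c t : ℝ) : HasDerivAt (fun s => sstep (s - c)) (dsstep (t - c)) t := by
  have h := (hasDerivAt_sstep (t - c)).comp t ((hasDerivAt_id t).sub_const c)
  rw [mul_one] at h
  exact h

theorem continuous_sstep : Continuous sstep := by unfold sstep; fun_prop
theorem continuous_dsstep : Continuous dsstep := by unfold dsstep; fun_prop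

theorem abs_dsstep_le {u : ℝ} (h0 : 0 ≤ u) (h1 : u ≤ 1) : |dsstep u| ≤ 12 := by
  rw [dsstep, abs_le]
  constructor <;> nlinarith

namespace WSlab

variable (r : IntegralRep n) (j : ℕ)

/-- `dsstep (X_last − j)` as a polynomial function is semialgebraic on the slab. -/
theorem isSemialgebraicFunOn_dsstep_last {s : Set (Fin (n + 1) → ℝ)} (hs : IsSemialgebraic ℚ s) (c : ℚ) :
    IsSemialgebraicFunOn ℚ s (fun z => dsstep (z (Fin.last n) - c)) := by
  have h := isSemialgebraicFunOn_aeval hs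
    (6 * (MvPolynomial.X (Fin.last n) - MvPolynomial.C c) -
      6 * (MvPolynomial.X (Fin.last n) - MvPolynomial.C c) ^ 2 : MvPolynomial (Fin (n + 1)) ℚ)
  refine h.congr fun z _ => ?_
  simp [dsstep]

theorem isSemialgebraicFunOn_sstep_last {s : Set (Fin (n + 1) → ℝ)} (hs : IsSemialgebraic ℚ s) (c : ℚ) :
    IsSemialgebraicFunOn ℚ s (fun z => sstep (z (Fin.last n) - c)) := by
  have h := isSemialgebraicFunOn_aeval hs
    (3 * (MvPolynomial.X (Fin.last n) - MvPolynomial.C c) ^ 2 -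
      2 * (MvPolynomial.X (Fin.last n) - MvPolynomial.C c) ^ 3 : MvPolynomial (Fin (n + 1)) ℚ)
  refine h.congr fun z _ => ?_
  simp [sstep]

/-- **Weighted slab** over `r = (σ, f)` at level `j`: domain `σ × [j, j+1]`, integrand
`f(x) · φ'(t − j)`. -/
def wslab : IntegralRep (n + 1) where
  domain := r.slabDomain j
  integrand z := r.integrand (Fin.init z) * dsstep (z (Fin.last n) - j)
  isSemialgebraic_domain := r.isSemialgebraic_slabDomain j
  isSemialgebraicFunOn_integrand := by
    have h1 : IsSemialgebraicFunOn ℚ (r.slabDomain j) (fun z => r.integrand (Fin.init z)) :=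
      (r.slab j).isSemialgebraicFunOn_integrand
    have h2 := isSemialgebraicFunOn_dsstep_last (r.isSemialgebraic_slabDomain j) (j : ℚ)
    exact IsSemialgebraicFunOn.mul_holds h1 h2
  integrableOn := by
    have hf : IntegrableOn (fun z : Fin (n + 1) → ℝ => r.integrand (Fin.init z)) (r.slabDomain j) :=
      r.integrableOn_slabDomain j
    have hmeas : MeasurableSet (r.slabDomain j) :=
      Literature.ModelTheory.ExponentialFields.IsSemialgebraic.measurableSet_holds
        (r.isSemialgebraic_slabDomain j)
    refine Integrable.mul_bdd (c := 12) hf ?_ ?_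
    · exact (continuous_dsstep.comp ((continuous_apply _).sub continuous_const)).aestronglyMeasurable
    · rw [ae_restrict_iff' hmeas]
      refine ae_of_all _ fun z hz => ?_
      rw [Real.norm_eq_abs]
      obtain ⟨-, h0, h1⟩ := hz
      exact abs_dsstep_le (by linarith) (by linarith)

@[simp] theorem domain_wslab : (wslab r j).domain = r.slabDomain j := rfl
@[simp] theorem integrand_wslab :
    (wslab r j).integrand = fun z => r.integrand (Fin.init z) * dsstep (z (Fin.last n) - j) := rfl

/-- `[wslab r j] − [r]` is ONE Newton–Leibniz move: primitive `f(x) φ(t − j)`, edges `j ≤ j+1`,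
boundary `f(x)(φ(1) − φ(0)) = f(x)`. -/
theorem of_wslab_sub_of_mem_newtonLeibnizRel : of (wslab r j) - of r ∈ newtonLeibnizRel := by
  refine ⟨n, wslab r j, r, fun _ => (j : ℝ), fun _ => (j : ℝ) + 1,
    fun z => r.integrand (Fin.init z) * sstep (z (Fin.last n) - j), ?_,
    isSemialgebraicFunOn_natCast r.isSemialgebraic_domain j, ?_, fun _ _ => by linarith, rfl,
    ?_, ?_, ?_, rfl⟩
  · have h1 : IsSemialgebraicFunOn ℚ (r.slabDomain j) (fun z => r.integrand (Fin.init z)) :=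
      (r.slab j).isSemialgebraicFunOn_integrand
    have h2 := isSemialgebraicFunOn_sstep_last (r.isSemialgebraic_slabDomain j) (j : ℚ)
    have h3 := IsSemialgebraicFunOn.mul_holds h1 h2
    refine h3.congr fun z _ => ?_
    simp
  · exact (isSemialgebraicFunOn_aeval r.isSemialgebraic_domain
      ((j : MvPolynomial (Fin n) ℚ) + 1)).congr fun x _ => by simp
  · intro x _
    simp only [Fin.snoc_last, Fin.init_snoc]
    exact (continuous_const.mul (continuous_sstep.comp (continuous_id.sub continuous_const))).continuousOn
  · intro x _ t _
    simp only [integrand_wslab, Fin.snoc_last, Fin.init_snoc]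
    exact (hasDerivAt_sstep_sub (j : ℝ) t).const_mul _
  · intro x _
    simp only [Fin.snoc_last, Fin.init_snoc]
    simp

end WSlab

open WSlab

/-- A coordinate hyperplane `{z_last = c}` of `ℝⁿ⁺¹` is Lebesgue-null. -/
theorem volume_setOf_last_eq (c : ℝ) : volume {z : Fin (n + 1) → ℝ | z (Fin.last n) = c} = 0 := by
  have hset : {z : Fin (n + 1) → ℝ | z (Fin.last n) = c} =
      Set.pi univ (fun i => if i = Fin.last n then ({c} : Set ℝ) else univ) := by
    ext z
    simp only [mem_setOf_eq, mem_pi, mem_univ, true_implies]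
    constructor
    · intro h i
      split_ifs with hi
      · subst hi; simpa using h
      · exact mem_univ _
    · intro h
      simpa using h (Fin.last n)
  rw [hset, volume_pi, Measure.pi_pi]
  apply Finset.prod_eq_zero (Finset.mem_univ (Fin.last n))
  simp

section Glue

variable (r r₁ r₂ : IntegralRep n) (h₁ : r₁.domain = r.domain) (h₂ : r₂.domain = r.domain)

/-- The double slab `σ × [0, 2]`. -/
def dslabDomain : Set (Fin (n + 1) → ℝ) :=
  {z | Fin.init z ∈ r.domain ∧ (0 : ℝ) ≤ z (Fin.last n) ∧ z (Fin.last n) ≤ 2}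

include h₁ h₂ in
theorem dslabDomain_eq_union : dslabDomain r = r₁.slabDomain 0 ∪ r₂.slabDomain 1 := by
  ext z
  simp only [dslabDomain, IntegralRep.slabDomain, h₁, h₂, mem_setOf_eq, mem_union, Nat.cast_zero,
    Nat.cast_one]
  constructor
  · rintro ⟨hz, h0, h2⟩
    rcases le_total (z (Fin.last n)) 1 with h | h
    · exact Or.inl ⟨hz, h0, by linarith⟩
    · exact Or.inr ⟨hz, h, by linarith⟩
  · rintro (⟨hz, h0, h1⟩ | ⟨hz, h0, h1⟩)
    · exact ⟨hz, h0, by linarith⟩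
    · exact ⟨hz, by linarith, by linarith⟩

theorem isSemialgebraic_dslabDomain : IsSemialgebraic ℚ (dslabDomain r) := by
  have h1 : IsSemialgebraic ℚ {z : Fin (n + 1) → ℝ | (0 : ℝ) ≤ z (Fin.last n)} := by
    simpa using Literature.ModelTheory.ExponentialFields.isSemialgebraic_setOf_eval_le (k := ℚ) (R := ℝ)
      (0 : MvPolynomial (Fin (n + 1)) ℚ) (MvPolynomial.X (Fin.last n))
  have h2 : IsSemialgebraic ℚ {z : Fin (n + 1) → ℝ | z (Fin.last n) ≤ 2} := by
    simpa using Literature.ModelTheory.ExponentialFields.isSemialgebraic_setOf_eval_le (k := ℚ) (R := ℝ)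
      (MvPolynomial.X (Fin.last n)) ((2 : MvPolynomial (Fin (n + 1)) ℚ))
  convert (r.isSemialgebraic_domain.setOf_init_mem.inter h1).inter h2 using 1
  ext z
  simp only [dslabDomain, mem_setOf_eq, mem_inter_iff, and_assoc]

/-- The glued integrand: `f₁(x) φ'(t)` for `t ≤ 1`, `f₂(x) φ'(t − 1)` for `t ≥ 1` (they agree,
`= 0`, at `t = 1`). -/
def gluedFun (z : Fin (n + 1) → ℝ) : ℝ :=
  if z (Fin.last n) ≤ 1 then (wslab r₁ 0).integrand z else (wslab r₂ 1).integrand z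

theorem gluedFun_eqOn_left : EqOn (gluedFun r₁ r₂) (wslab r₁ 0).integrand (r₁.slabDomain 0) := by
  intro z hz
  have : z (Fin.last n) ≤ 1 := by have := hz.2.2; push_cast at this; linarith
  simp [gluedFun, this]

theorem gluedFun_eqOn_right : EqOn (gluedFun r₁ r₂) (wslab r₂ 1).integrand (r₂.slabDomain 1) := by
  intro z hz
  have h1 : 1 ≤ z (Fin.last n) := by have := hz.2.1; push_cast at this; linarith
  by_cases h : z (Fin.last n) ≤ 1
  · have heq : z (Fin.last n) = 1 := le_antisymm h h1
    simp [gluedFun, heq]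
  · simp [gluedFun, h]

/-- **The glued representation** `R = [σ × [0,2], glued]`. -/
def glued : IntegralRep (n + 1) where
  domain := dslabDomain r
  integrand := gluedFun r₁ r₂
  isSemialgebraic_domain := isSemialgebraic_dslabDomain r
  isSemialgebraicFunOn_integrand := by
    rw [dslabDomain_eq_union r r₁ r₂ h₁ h₂]
    exact IsSemialgebraicFunOn.union (wslab r₁ 0).isSemialgebraicFunOn_integrand
      (wslab r₂ 1).isSemialgebraicFunOn_integrand (gluedFun_eqOn_left r₁ r₂) (gluedFun_eqOn_right r₁ r₂)
  integrableOn := by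
    rw [dslabDomain_eq_union r r₁ r₂ h₁ h₂]
    refine IntegrableOn.union ?_ ?_
    · exact (wslab r₁ 0).integrableOn.congr_fun (gluedFun_eqOn_left r₁ r₂).symm
        (Literature.ModelTheory.ExponentialFields.IsSemialgebraic.measurableSet_holds
          (r₁.isSemialgebraic_slabDomain 0))
    · exact (wslab r₂ 1).integrableOn.congr_fun (gluedFun_eqOn_right r₁ r₂).symm
        (Literature.ModelTheory.ExponentialFields.IsSemialgebraic.measurableSet_holds
          (r₂.isSemialgebraic_slabDomain 1))

/-- `[R] − [wslab r₁ 0] − [wslab r₂ 1]` is ONE domain-additivity move (overlap `σ × {1}` null). -/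
theorem of_glued_sub_sub_mem_domainAddRel :
    of (glued r r₁ r₂ h₁ h₂) - of (wslab r₁ 0) - of (wslab r₂ 1) ∈ domainAddRel := by
  refine ⟨n + 1, glued r r₁ r₂ h₁ h₂, wslab r₁ 0, wslab r₂ 1, dslabDomain_eq_union r r₁ r₂ h₁ h₂,
    ?_, gluedFun_eqOn_left r₁ r₂, gluedFun_eqOn_right r₁ r₂, rfl⟩
  refine measure_mono_null (fun z hz => ?_) (volume_setOf_last_eq (n := n) 1)
  obtain ⟨⟨-, -, ha⟩, ⟨-, hb, -⟩⟩ := hz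
  push_cast at ha hb
  exact le_antisymm (by linarith) (by linarith)

/-- The glued primitive: `f₁(x) φ(t)` for `t ≤ 1`, `f₁(x) + f₂(x) φ(t − 1)` for `t ≥ 1`. -/
def gluedPrim (z : Fin (n + 1) → ℝ) : ℝ :=
  if z (Fin.last n) ≤ 1 then r₁.integrand (Fin.init z) * sstep (z (Fin.last n) - (0 : ℕ))
  else r₁.integrand (Fin.init z) + r₂.integrand (Fin.init z) * sstep (z (Fin.last n) - (1 : ℕ))

include h₁ h₂ in
theorem isSemialgebraicFunOn_gluedPrim : IsSemialgebraicFunOn ℚ (dslabDomain r) (gluedPrim r₁ r₂) := by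
  rw [dslabDomain_eq_union r r₁ r₂ h₁ h₂]
  have hA : IsSemialgebraicFunOn ℚ (r₁.slabDomain 0)
      (fun z => r₁.integrand (Fin.init z) * sstep (z (Fin.last n) - (0 : ℕ))) := by
    have h1 : IsSemialgebraicFunOn ℚ (r₁.slabDomain 0) (fun z => r₁.integrand (Fin.init z)) :=
      (r₁.slab 0).isSemialgebraicFunOn_integrand
    have h2 := isSemialgebraicFunOn_sstep_last (r₁.isSemialgebraic_slabDomain 0) ((0 : ℕ) : ℚ)
    refine (IsSemialgebraicFunOn.mul_holds h1 h2).congr fun z _ => ?_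
    simp
  have hB : IsSemialgebraicFunOn ℚ (r₂.slabDomain 1)
      (fun z => r₁.integrand (Fin.init z) + r₂.integrand (Fin.init z) * sstep (z (Fin.last n) - (1 : ℕ))) := by
    have h0 : IsSemialgebraicFunOn ℚ (r₂.slabDomain 1) (fun z => r₁.integrand (Fin.init z)) := by
      refine r₁.isSemialgebraicFunOn_integrand.comp_init.mono (fun z hz => ?_) (r₂.isSemialgebraic_slabDomain 1)
      have : Fin.init z ∈ r₂.domain := hz.1
      rw [h₂, ← h₁] at this
      exact this
    have h1 : IsSemialgebraicFunOn ℚ (r₂.slabDomain 1) (fun z => r₂.integrand (Fin.init z)) :=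
      (r₂.slab 1).isSemialgebraicFunOn_integrand
    have h2 := isSemialgebraicFunOn_sstep_last (r₂.isSemialgebraic_slabDomain 1) ((1 : ℕ) : ℚ)
    have h3 := IsSemialgebraicFunOn.mul_holds h1 h2
    refine (IsSemialgebraicFunOn.add_holds h0 h3).congr fun z _ => ?_
    simp
  refine IsSemialgebraicFunOn.union hA hB (fun z hz => ?_) (fun z hz => ?_)
  · have : z (Fin.last n) ≤ 1 := by have := hz.2.2; push_cast at this; linarith
    simp [gluedPrim, this]
  · have h1' : 1 ≤ z (Fin.last n) := by have := hz.2.1; push_cast at this; linarith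
    by_cases h : z (Fin.last n) ≤ 1
    · have heq : z (Fin.last n) = 1 := le_antisymm h h1'
      simp [gluedPrim, heq]
    · simp [gluedPrim, h]

/-- The fibre of the glued primitive, as a function of `t`. -/
theorem gluedPrim_snoc (x : Fin n → ℝ) (t : ℝ) :
    gluedPrim r₁ r₂ (Fin.snoc x t) =
      if t ≤ 1 then r₁.integrand x * sstep t else r₁.integrand x + r₂.integrand x * sstep (t - 1) := by
  simp [gluedPrim]

theorem gluedFun_snoc (x : Fin n → ℝ) (t : ℝ) :
    gluedFun r₁ r₂ (Fin.snoc x t) =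
      if t ≤ 1 then r₁.integrand x * dsstep t else r₂.integrand x * dsstep (t - 1) := by
  simp [gluedFun]

theorem continuous_gluedPrim_snoc (x : Fin n → ℝ) :
    Continuous (fun t : ℝ => gluedPrim r₁ r₂ (Fin.snoc x t)) := by
  simp_rw [gluedPrim_snoc]
  refine Continuous.if_le ?_ ?_ continuous_id continuous_const ?_
  · exact continuous_const.mul continuous_sstep
  · exact continuous_const.add (continuous_const.mul (continuous_sstep.comp (continuous_id.sub continuous_const)))
  · intro t ht
    simp [ht]

theorem hasDerivAt_gluedPrim_snoc (x : Fin n → ℝ) (t : ℝ) :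
    HasDerivAt (fun s : ℝ => gluedPrim r₁ r₂ (Fin.snoc x s)) (gluedFun r₁ r₂ (Fin.snoc x t)) t := by
  simp_rw [gluedPrim_snoc, gluedFun_snoc]
  set f₁ := r₁.integrand x
  set f₂ := r₂.integrand x
  have hL : ∀ s, HasDerivAt (fun s : ℝ => f₁ * sstep s) (f₁ * dsstep s) s :=
    fun s => (hasDerivAt_sstep s).const_mul f₁
  have hR : ∀ s, HasDerivAt (fun s : ℝ => f₁ + f₂ * sstep (s - 1)) (f₂ * dsstep (s - 1)) s :=
    fun s => by simpa using ((hasDerivAt_sstep_sub 1 s).const_mul f₂).const_add f₁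
  rcases lt_trichotomy t 1 with ht | rfl | ht
  · have hev : (fun s : ℝ => if s ≤ 1 then f₁ * sstep s else f₁ + f₂ * sstep (s - 1)) =ᶠ[nhds t]
        fun s => f₁ * sstep s := by
      filter_upwards [Iio_mem_nhds ht] with s hs
      have hs' : s < 1 := hs
      simp [hs'.le]
    rw [if_pos ht.le]
    exact (hL t).congr_of_eventuallyEq hev
  · -- the junction: both one-sided derivatives vanish
    rw [if_pos le_rfl, dsstep_one, mul_zero]
    have hleft : HasDerivWithinAt (fun s : ℝ => if s ≤ 1 then f₁ * sstep s else f₁ + f₂ * sstep (s - 1))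
        0 (Iic 1) 1 := by
      have h := (hL 1).hasDerivWithinAt (s := Iic 1)
      rw [dsstep_one, mul_zero] at h
      exact h.congr (fun s hs => by simp [show s ≤ 1 from hs]) (by simp)
    have hright : HasDerivWithinAt (fun s : ℝ => if s ≤ 1 then f₁ * sstep s else f₁ + f₂ * sstep (s - 1))
        0 (Ici 1) 1 := by
      have h := (hR 1).hasDerivWithinAt (s := Ici 1)
      rw [sub_self, dsstep_zero, mul_zero] at h
      refine h.congr (fun s hs => ?_) (by simp)
      by_cases hs1 : s ≤ 1
      · have : s = 1 := le_antisymm hs1 hs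
        subst this; simp
      · simp [hs1]
    have := hleft.union hright
    rw [Iic_union_Ici] at this
    exact this.hasDerivAt Filter.univ_mem
  · have hev : (fun s : ℝ => if s ≤ 1 then f₁ * sstep s else f₁ + f₂ * sstep (s - 1)) =ᶠ[nhds t]
        fun s => f₁ + f₂ * sstep (s - 1) := by
      filter_upwards [Ioi_mem_nhds ht] with s hs
      have hs' : 1 < s := hs
      simp [not_le.mpr hs']
    rw [if_neg (not_le.mpr ht)]
    exact (hR t).congr_of_eventuallyEq hev

/-- `[R] − [r]` is ONE Newton–Leibniz move when `f = f₁ + f₂` on `σ`: primitive `gluedPrim`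
(C¹ across `t = 1`), edges `0 ≤ 2`, boundary `(f₁ + f₂ φ(1)) − f₁ φ(0) = f₁ + f₂ = f`. -/
theorem of_glued_sub_of_mem_newtonLeibnizRel
    (hadd : EqOn r.integrand (r₁.integrand + r₂.integrand) r.domain) :
    of (glued r r₁ r₂ h₁ h₂) - of r ∈ newtonLeibnizRel := by
  refine ⟨n, glued r r₁ r₂ h₁ h₂, r, fun _ => (0 : ℝ), fun _ => (2 : ℝ), gluedPrim r₁ r₂,
    isSemialgebraicFunOn_gluedPrim r r₁ r₂ h₁ h₂, ?_, ?_, fun _ _ => by norm_num, rfl, ?_, ?_, ?_, rfl⟩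
  · exact (isSemialgebraicFunOn_natCast r.isSemialgebraic_domain 0).congr fun x _ => by simp
  · exact (isSemialgebraicFunOn_natCast r.isSemialgebraic_domain 2).congr fun x _ => by simp
  · intro x _
    exact (continuous_gluedPrim_snoc r₁ r₂ x).continuousOn
  · intro x _ t _
    exact hasDerivAt_gluedPrim_snoc r₁ r₂ x t
  · intro x hx
    rw [hadd hx, gluedPrim_snoc, gluedPrim_snoc]
    norm_num

end Glue

/-- **Rule 1b is derivable from rules 1a and 3.** `integrandAddRel ⊆ closure (domainAddRel ∪
newtonLeibnizRel)`: `[σ,f] − [σ,f₁] − [σ,f₂] = −([R] − [σ,f]) + ([R] − [W₁] − [W₂]) + ([W₁] − [σ,f₁])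
+ ([W₂] − [σ,f₂])` with `R` the glued double slab and `Wᵢ` the weighted slabs. Hence dropping
rule 1b from the H21 calculus changes nothing. -/
theorem integrandAddRel_subset_closure_domainAdd_newtonLeibniz :
    integrandAddRel ⊆ (AddSubgroup.closure (domainAddRel ∪ newtonLeibnizRel) : Set FormalRep) := by
  rintro c ⟨n, r, r₁, r₂, h₁, h₂, hadd, rfl⟩
  set S := AddSubgroup.closure (domainAddRel ∪ newtonLeibnizRel)
  have hNL : newtonLeibnizRel ⊆ (S : Set FormalRep) := subset_union_right.trans AddSubgroup.subset_closure
  have hDA : domainAddRel ⊆ (S : Set FormalRep) := subset_union_left.trans AddSubgroup.subset_closure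
  have e1 := hNL (of_glued_sub_of_mem_newtonLeibnizRel r r₁ r₂ h₁ h₂ hadd)
  have e2 := hDA (of_glued_sub_sub_mem_domainAddRel r r₁ r₂ h₁ h₂)
  have e3 := hNL (WSlab.of_wslab_sub_of_mem_newtonLeibnizRel r₁ 0)
  have e4 := hNL (WSlab.of_wslab_sub_of_mem_newtonLeibnizRel r₂ 1)
  have : of r - of r₁ - of r₂ =
      -(of (glued r r₁ r₂ h₁ h₂) - of r) + (of (glued r r₁ r₂ h₁ h₂) - of (wslab r₁ 0) - of (wslab r₂ 1))
        + (of (wslab r₁ 0) - of r₁) + (of (wslab r₂ 1) - of r₂) := by abel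
  rw [SetLike.mem_coe, this]
  exact S.add_mem (S.add_mem (S.add_mem (S.neg_mem e1) e2) e3) e4

/-- Consequently the calculus without rule 1b has the SAME relations ("hypothesis 1b unnecessary"):
`NormalFormPrincipleMod (closure (1a ∪ 2 ∪ 3)) ↔ NormalFormPrinciple`. -/
theorem closure_without_integrandAdd_eq_relations :
    AddSubgroup.closure (domainAddRel ∪ changeOfVariablesRel ∪ newtonLeibnizRel) = relations := by
  apply le_antisymm
  · exact AddSubgroup.closure_mono (union_subset (union_subset
      ((subset_union_left.trans subset_union_left).trans subset_union_left)
      (subset_union_right.trans subset_union_left)) subset_union_right)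
  · refine (AddSubgroup.closure_le _).mpr ?_
    rintro c (((hc | hc) | hc) | hc)
    · exact AddSubgroup.subset_closure (Or.inl (Or.inl hc))
    · have h := integrandAddRel_subset_closure_domainAdd_newtonLeibniz hc
      exact AddSubgroup.closure_mono (union_subset (subset_union_left.trans subset_union_left)
        subset_union_right) h
    · exact AddSubgroup.subset_closure (Or.inl (Or.inr hc))
    · exact AddSubgroup.subset_closure (Or.inr hc)


/-- The crux over the calculus without rule 1b is the crux itself. -/
theorem normalFormPrincipleMod_without_integrandAdd_iff :
    NormalFormPrincipleMod (AddSubgroup.closure (domainAddRel ∪ changeOfVariablesRel ∪ newtonLeibnizRel)) ↔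
      NormalFormPrinciple := by
  rw [closure_without_integrandAdd_eq_relations]
  exact normalFormPrinciple_iff_mod.symm

/-! ## §5 A refuted natural strengthening: finitely many normal VALUES -/

/-- The rational constant `[pt, q]` in dimension 0. -/
def constPt (q : ℚ) : IntegralRep 0 where
  domain := univ
  integrand := fun _ => (q : ℝ)
  isSemialgebraic_domain := Literature.ModelTheory.ExponentialFields.isSemialgebraic_univ
  isSemialgebraicFunOn_integrand := by
    simpa using isSemialgebraicFunOn_aeval
      (Literature.ModelTheory.ExponentialFields.isSemialgebraic_univ (k := ℚ) (ι := Fin 0) (R := ℝ))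
      (MvPolynomial.C q : MvPolynomial (Fin 0) ℚ)
  integrableOn := integrableOn_const (hs := by simp [volume_univ_fin_zero])

theorem isRational_constPt (q : ℚ) : (constPt q).IsRational :=
  ⟨MvPolynomial.C q, 1, fun _ _ => by simp, fun _ _ => by simp [constPt]⟩

@[simp] theorem value_constPt (q : ℚ) : (constPt q).value = q := by
  simp [IntegralRep.value, constPt, Measure.restrict_univ, measureReal_def, volume_univ_fin_zero]

/-- **No finite set of normal VALUES suffices**: a family `𝒩` to which every rational
representation reduces (by sound relations) takes infinitely many values, since every rational
number is the value of a rational representation. In particular `NormalFormPrinciple` cannot be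
strengthened to a finite `𝒩`. -/
theorem not_exists_finite_values {S : AddSubgroup FormalRep} (hS : S ≤ eval.ker) :
    ¬ ∃ 𝒩 : Family, (⋃ n, IntegralRep.value '' 𝒩 n).Finite ∧ ReductionMod S 𝒩 := by
  rintro ⟨𝒩, hfin, hred⟩
  have hsub : range (fun q : ℚ => (q : ℝ)) ⊆ ⋃ n, IntegralRep.value '' 𝒩 n := by
    rintro _ ⟨q, rfl⟩
    obtain ⟨m, N, hN, hqN⟩ := hred 0 (constPt q) (isRational_constPt q)
    refine mem_iUnion.mpr ⟨m, N, hN, ?_⟩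
    rw [← value_eq_of_sub_mem hS _ _ hqN, value_constPt]
  exact ((infinite_range_of_injective Rat.cast_injective).mono hsub) hfin

/-- The crux itself cannot be witnessed by a family with finitely many values. -/
theorem not_exists_finite_values_relations :
    ¬ ∃ 𝒩 : Family, (⋃ n, IntegralRep.value '' 𝒩 n).Finite ∧ ReductionMod relations 𝒩 :=
  not_exists_finite_values relations_le_ker

/-! ## §6 Formalisation-bug hunt: the degenerate representations are handled by rule 1 -/

/-- Null-domain representations are relations (rule 1a with `σ = σ ∪ σ`, overlap null). -/
theorem of_nullDomain_mem_relations (r : IntegralRep n) (h : volume r.domain = 0) :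
    of r ∈ relations := by
  have hmem : of r - of r - of r ∈ domainAddRel :=
    ⟨n, r, r, r, by simp, by simpa using h, fun _ _ => rfl, fun _ _ => rfl, rfl⟩
  have := relations.neg_mem (domainAddRel_subset_relations hmem)
  simpa using this

/-- Zero-integrand representations are relations (rule 1b with `0 = 0 + 0`). -/
theorem of_zeroIntegrand_mem_relations (r : IntegralRep n) (h : EqOn r.integrand 0 r.domain) :
    of r ∈ relations := by
  have hmem : of r - of r - of r ∈ integrandAddRel :=
    ⟨n, r, r, r, rfl, rfl, fun x hx => by simp [h hx], rfl⟩
  have := relations.neg_mem (integrandAddRel_subset_relations hmem)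
  simpa using this

/-! ## §7 Targets (lead's stuck stubs): none at cycle 1 (payload.targets = []). -/

end Summit.KontsevichZagierPeriods.KontsevichZagierPeriods.Cruxes.NormalFormPrinciple.Disproof
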